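import Literature.NumberTheory.Transcendental.KZCubeRational
import Literature.NumberTheory.Transcendental.KZCubeRationalMoves
import Literature.NumberTheory.Transcendental.ShuffleRegEndCons
import Literature.NumberTheory.Transcendental.KZProductIdeal
import Literature.NumberTheory.Transcendental.KZLogCalculusProofs
import Literature.NumberTheory.Transcendental.KZGroundingRelations
import Literature.NumberTheory.Transcendental.DrinfeldAssociatorRegularisation
import Literature.NumberTheory.Transcendental.DrinfeldAssociatorEdge
import Literature.NumberTheory.Transcendental.AssociatorsEval
import Literature.ModelTheory.ExponentialFields.SemialgebraicInterior
import HarnessLib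

/-!
# The cube calculus of end-regularised iterated integrals, I: words, families, the moves (S), (O)

Iterated integrals `∫_{c > t₀ > … > t_{n-1} > 0} ∏ᵢ N_{aᵢ} dtᵢ/(N_{aᵢ} tᵢ + M_{aᵢ})` of rational
`dlog`-forms (letters `a` of an alphabet, `N_a, M_a` polynomials in RIDER parameters) are written
on the unit cube by `tᵢ = c τ x₀ ⋯ xᵢ` (`τ` a SCALE coordinate), where the integrand is a regular
rational function `Zw` (`KZ.RFun`, file `KZCubeRational`) and every identity between such
integrals becomes an instance of the Kontsevich–Zagier rules [KontsevichZagier2001, §1.2] in the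
form of `KZCubeRationalMoves` (additivity, Stokes = Ayoub's relation, change of variables, dummy
variables, Fubini).  This file sets up

* letters and word functions `Zw`, their peeling recursion (`fn_Zw_cons`), FAMILIES
  `famTerm ρ T π` (a multiplier `ρ` of the riders times the word function read at the rider scale
  `π`), the rider Stokes move and Euler homogeneity, the head/last factors;
* **(S)** (`chi_famTerm_eq_scaleDeriv`): reading a family at scale `π` equals reading the
  `τ`-derivative family `∂_τ(τ·)` one rider up at scale `π v` — Stokes in a new rider;
* **(O)** (`Dser_cons`, `DS_succ`): the transport (differential) equation of the end-regularised
  generating series `𝐙(ρ,π)(W) = ⟨zcoef, regEnd o W⟩` at the level of words, series and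
  residues — Stokes along the first word coordinate, the end regularisation of
  Ihara–Kaneko–Zagier [IharaKanekoZagier2006, §3, Cor. 5] entering through
  `Shuffle.regEnd_apply_cons`;
* the transverse rider `Y` (the last letter rider) and the substitution `famY` of `Y` by a rider
  polynomial, scale-reading factors `scaleFam`, and the `NCSeries.evalW` bookkeeping.

References: M. Kontsevich, D. Zagier, *Periods* (2001), §1.2 [cite: KontsevichZagier2001, §1.2];
K. Ihara, M. Kaneko, D. Zagier, Compos. Math. 142 (2006), §3 [cite: IharaKanekoZagier2006, §3];
J. Ayoub, EMS Newsl. 91 (2014), Def. 10; H. Furusho, Ann. of Math. 171 (2010), §3 (the use of these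
moves for the corner identities of the KZ associator).
-/

noncomputable section

open MeasureTheory Set MvPolynomial
open Literature.ModelTheory.ExponentialFields (IsSemialgebraic analyticOnNhd_aeval continuous_aeval_real)
open Literature.NumberTheory.Transcendental

namespace Literature.NumberTheory.Transcendental.KZ.Cube

variable {M N : ℕ}

/-! ## Letters and scaled word functions in cube form (layer W)

Layout of the variables of a word function: `Fin ((n + m) + 1)` = the `n` WORD coordinates `x`
first, then the `m` RIDER coordinates `s` (on which the pole data depend), then the SCALE
coordinate `τ` LAST (so that `RFun.dlast`/`RFun.face` act on the scale, and adding riders to a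
family adds coordinates at the end).  With a chart bound `c̄ ∈ ℚ_{≥0}` the scaled simplex variables
are `uᵢ = c̄ τ x₀ ⋯ xᵢ`. -/

section Words

variable {m : ℕ}

/-- A LETTER over `m` rider coordinates: the pole at the origin `dt/t` (`inv`, the letter that is
regularised and never innermost) or a regular pole datum `(N, M)` standing for the 1-form
`N dt/(N t + M)` (pole at `t = −M/N`, residue `1`; `N = 0` is allowed and gives the zero form).
[cite: KontsevichZagier2001, §1.1] -/
inductive Letter (m : ℕ) : Type
  | inv : Letter m
  | reg (N M : MvPolynomial (Fin m) ℚ) : Letter m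

namespace Letter

/-- A letter is REGULAR up to the bound `c̄` if its form has no pole on `[0, c̄]` for any rider value
in the cube. [folklore] -/
def IsRegular (c : ℚ) : Letter m → Prop
  | inv => True
  | reg N M => ∀ s ∈ KZ.cube m, ∀ t : ℝ, 0 ≤ t → t ≤ c → aeval s N * t + aeval s M ≠ 0

/-- The real non-innermost factor `c_ℓ(t)` of a letter (`1` for `inv`, `N t/(N t + M)` for a regular
pole). [folklore] -/
def cR (ℓ : Letter m) (s : Fin m → ℝ) (t : ℝ) : ℝ :=
  match ℓ with
  | inv => 1
  | reg N M => aeval s N * t / (aeval s N * t + aeval s M)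

/-- The real innermost factor `last_ℓ(t)` of a letter (`N/(N t + M)`; junk `1` for `inv`).
[folklore] -/
def lastR (ℓ : Letter m) (s : Fin m → ℝ) (t : ℝ) : ℝ :=
  match ℓ with
  | inv => 1
  | reg N M => aeval s N / (aeval s N * t + aeval s M)

variable {n : ℕ}

/-- The embedding of rider polynomials into the word layout. [folklore] -/
abbrev emb (n : ℕ) (P : MvPolynomial (Fin m) ℚ) : MvPolynomial (Fin ((n + m) + 1)) ℚ :=
  MvPolynomial.rename (Fin.castSucc ∘ Fin.natAdd n) P

/-- Numerator polynomial of the non-innermost factor at the scaled variable `u`. [folklore] -/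
def cfNum (ℓ : Letter m) (u : MvPolynomial (Fin ((n + m) + 1)) ℚ) : MvPolynomial (Fin ((n + m) + 1)) ℚ :=
  match ℓ with
  | inv => 1
  | reg N _ => emb n N * u

/-- Denominator polynomial of a factor at the scaled variable `u`. [folklore] -/
def cfDen (ℓ : Letter m) (u : MvPolynomial (Fin ((n + m) + 1)) ℚ) : MvPolynomial (Fin ((n + m) + 1)) ℚ :=
  match ℓ with
  | inv => 1
  | reg N M => emb n N * u + emb n M

/-- Numerator polynomial of the innermost factor. [folklore] -/
def lastNum (ℓ : Letter m) : MvPolynomial (Fin ((n + m) + 1)) ℚ :=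
  match ℓ with
  | inv => 1
  | reg N _ => emb n N

/-- `cfNum` of `inv`. [folklore] -/
@[simp] theorem cfNum_inv (u : MvPolynomial (Fin ((n + m) + 1)) ℚ) : (inv : Letter m).cfNum u = 1 := rfl
/-- `cfNum` of a regular letter. [folklore] -/
@[simp] theorem cfNum_reg (N M : MvPolynomial (Fin m) ℚ) (u : MvPolynomial (Fin ((n + m) + 1)) ℚ) :
    (reg N M).cfNum u = emb n N * u := rfl
/-- `cfDen` of `inv`. [folklore] -/
@[simp] theorem cfDen_inv (u : MvPolynomial (Fin ((n + m) + 1)) ℚ) : (inv : Letter m).cfDen u = 1 := rfl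
/-- `cfDen` of a regular letter. [folklore] -/
@[simp] theorem cfDen_reg (N M : MvPolynomial (Fin m) ℚ) (u : MvPolynomial (Fin ((n + m) + 1)) ℚ) :
    (reg N M).cfDen u = emb n N * u + emb n M := rfl
/-- `lastNum` of `inv`. [folklore] -/
@[simp] theorem lastNum_inv : (inv : Letter m).lastNum (n := n) = 1 := rfl
/-- `lastNum` of a regular letter. [folklore] -/
@[simp] theorem lastNum_reg (N M : MvPolynomial (Fin m) ℚ) : (reg N M).lastNum (n := n) = emb n N := rfl
/-- `cR` of `inv`. [folklore] -/
@[simp] theorem cR_inv (s : Fin m → ℝ) (t : ℝ) : (inv : Letter m).cR s t = 1 := rfl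
/-- `cR` of a regular letter. [folklore] -/
@[simp] theorem cR_reg (N M : MvPolynomial (Fin m) ℚ) (s : Fin m → ℝ) (t : ℝ) :
    (reg N M).cR s t = aeval s N * t / (aeval s N * t + aeval s M) := rfl
/-- `lastR` of `inv`. [folklore] -/
@[simp] theorem lastR_inv (s : Fin m → ℝ) (t : ℝ) : (inv : Letter m).lastR s t = 1 := rfl
/-- `lastR` of a regular letter. [folklore] -/
@[simp] theorem lastR_reg (N M : MvPolynomial (Fin m) ℚ) (s : Fin m → ℝ) (t : ℝ) :
    (reg N M).lastR s t = aeval s N / (aeval s N * t + aeval s M) := rfl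

end Letter

variable {n : ℕ}

/-- Word coordinates of a word-layout point. [folklore] -/
def wX (z : Fin ((n + m) + 1) → ℝ) : Fin n → ℝ := fun j => z (Fin.castSucc (Fin.castAdd m j))

/-- Rider coordinates of a word-layout point. [folklore] -/
def wRider (z : Fin ((n + m) + 1) → ℝ) : Fin m → ℝ := fun j => z (Fin.castSucc (Fin.natAdd n j))

/-- Scale coordinate of a word-layout point. [folklore] -/
def wScale (z : Fin ((n + m) + 1) → ℝ) : ℝ := z (Fin.last (n + m))

/-- The scaled variable `uᵢ = c̄ τ x₀ ⋯ xᵢ` as a polynomial. [folklore] -/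
def uMon (c : ℚ) (n m : ℕ) (i : Fin n) : MvPolynomial (Fin ((n + m) + 1)) ℚ :=
  C c * X (Fin.last (n + m)) * ∏ j ∈ Finset.univ.filter (fun j : Fin n => j ≤ i), X (Fin.castSucc (Fin.castAdd m j))

/-- The scaled variable `uᵢ` as a real function. [folklore] -/
def uR (c : ℚ) (τ : ℝ) (x : Fin n → ℝ) (i : Fin n) : ℝ :=
  c * τ * ∏ j ∈ Finset.univ.filter (fun j : Fin n => j ≤ i), x j

/-- Evaluating `uMon`. [folklore] -/
theorem aeval_uMon (c : ℚ) (i : Fin n) (z : Fin ((n + m) + 1) → ℝ) :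
    aeval z (uMon c n m i) = uR c (wScale z) (wX z) i := by
  simp [uMon, uR, wScale, wX, map_prod]

/-- Evaluating an embedded rider polynomial. [folklore] -/
theorem aeval_emb (P : MvPolynomial (Fin m) ℚ) (z : Fin ((n + m) + 1) → ℝ) :
    aeval z (Letter.emb n P) = aeval (wRider z) P := by
  rw [Letter.emb, aeval_rename]; rfl

/-- On the cube the scaled variables lie in `[0, c̄]`. [folklore] -/
theorem uR_mem {c : ℚ} (hc : 0 ≤ c) {z : Fin ((n + m) + 1) → ℝ} (hz : z ∈ KZ.cube ((n + m) + 1)) (i : Fin n) :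
    0 ≤ uR c (wScale z) (wX z) i ∧ uR c (wScale z) (wX z) i ≤ c := by
  have hτ : 0 ≤ wScale z ∧ wScale z ≤ 1 := hz _
  have hx : ∀ j, 0 ≤ wX z j ∧ wX z j ≤ 1 := fun j => hz _
  have hp0 : 0 ≤ ∏ j ∈ Finset.univ.filter (fun j : Fin n => j ≤ i), wX z j :=
    Finset.prod_nonneg fun j _ => (hx j).1
  have hp1 : ∏ j ∈ Finset.univ.filter (fun j : Fin n => j ≤ i), wX z j ≤ 1 :=
    Finset.prod_le_one (fun j _ => (hx j).1) fun j _ => (hx j).2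
  have hc' : (0 : ℝ) ≤ c := by exact_mod_cast hc
  refine ⟨by unfold uR; exact mul_nonneg (mul_nonneg hc' hτ.1) hp0, ?_⟩
  calc uR c (wScale z) (wX z) i = c * (wScale z * ∏ j ∈ Finset.univ.filter (fun j : Fin n => j ≤ i), wX z j) := by
        unfold uR; ring
    _ ≤ c * 1 := by
        refine mul_le_mul_of_nonneg_left ?_ hc'
        calc wScale z * ∏ j ∈ Finset.univ.filter (fun j : Fin n => j ≤ i), wX z j ≤ 1 * 1 :=
              mul_le_mul hτ.2 hp1 hp0 zero_le_one
          _ = 1 := one_mul 1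
    _ = c := mul_one _

/-- The riders of a cube point lie in the cube. [folklore] -/
theorem wRider_mem {z : Fin ((n + m) + 1) → ℝ} (hz : z ∈ KZ.cube ((n + m) + 1)) : wRider z ∈ KZ.cube m :=
  fun _ => hz _

/-- The denominator polynomial of a letter does not vanish on the cube. [folklore] -/
theorem Letter.aeval_cfDen_ne {c : ℚ} (hc : 0 ≤ c) (ℓ : Letter m) (hℓ : ℓ.IsRegular c) (i : Fin n)
    {z : Fin ((n + m) + 1) → ℝ} (hz : z ∈ KZ.cube ((n + m) + 1)) :
    aeval z (ℓ.cfDen (uMon c n m i)) ≠ 0 := by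
  cases ℓ with
  | inv => simp
  | reg N M =>
    simp only [Letter.cfDen_reg, map_add, map_mul, aeval_emb, aeval_uMon]
    exact hℓ _ (wRider_mem hz) _ (uR_mem hc hz i).1 (uR_mem hc hz i).2

/-- **The word function `Z_v` in cube form**: for a word `v = a₀ ⋯ a_{n-1}` over an alphabet `ι`
with letter data `d` regular up to the chart bound `c̄`, the regular rational function
`∏_{i < n-1} c_{d aᵢ}(uᵢ) · last_{d a_{n-1}}(u_{n-1})`, `uᵢ = c̄ τ x₀ ⋯ xᵢ`, on `[0,1]^{(n+m)+1}` — the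
cube form of the iterated integral `∫_{c̄τ > t₀ > ⋯ > t_{n-1} > 0} ∏ Nᵢ dtᵢ/(Nᵢ tᵢ + Mᵢ)` divided by
its explicit factor `c̄ τ`. [cite: KontsevichZagier2001, §1.2] -/
def Zw {ι : Type} (c : ℚ) (hc : 0 ≤ c) (d : ι → Letter m) (hd : ∀ a, (d a).IsRegular c) (v : List ι) :
    RFun ((v.length + m) + 1) :=
  ⟨(∏ i ∈ Finset.univ.filter (fun i : Fin v.length => i.val + 1 < v.length), (d (v.get i)).cfNum (uMon c v.length m i)) *
      (match v.getLast? with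
        | some a => (d a).lastNum
        | none => 1),
    ∏ i : Fin v.length, (d (v.get i)).cfDen (uMon c v.length m i),
    fun z hz => by
      rw [map_prod]
      exact Finset.prod_ne_zero_iff.2 fun i _ => (d (v.get i)).aeval_cfDen_ne hc (hd _) i hz⟩

/-- The PEELED point: word coordinates shifted by one, riders unchanged, scale `τ x₀`.
[folklore] -/
def peelPt {n : ℕ} (z : Fin (((n + 1) + m) + 1) → ℝ) : Fin ((n + m) + 1) → ℝ :=
  Fin.snoc (Fin.append (fun j => wX z j.succ) (wRider z)) (wScale z * wX z 0)

/-- Riders of the peeled point. [folklore] -/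
@[simp] theorem wRider_peelPt {n : ℕ} (z : Fin (((n + 1) + m) + 1) → ℝ) : wRider (peelPt z) = wRider z := by
  funext j
  show peelPt z (Fin.castSucc (Fin.natAdd n j)) = wRider z j
  rw [peelPt, Fin.snoc_castSucc, Fin.append_right]

/-- Scale of the peeled point. [folklore] -/
@[simp] theorem wScale_peelPt {n : ℕ} (z : Fin (((n + 1) + m) + 1) → ℝ) : wScale (peelPt z) = wScale z * wX z 0 := by
  simp [wScale, peelPt]

/-- Word coordinates of the peeled point. [folklore] -/
@[simp] theorem wX_peelPt {n : ℕ} (z : Fin (((n + 1) + m) + 1) → ℝ) (j : Fin n) : wX (peelPt z) j = wX z j.succ := by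
  simp [wX, peelPt]

/-- The peeled point of a cube point lies in the cube. [folklore] -/
theorem peelPt_mem {n : ℕ} {z : Fin (((n + 1) + m) + 1) → ℝ} (hz : z ∈ KZ.cube (((n + 1) + m) + 1)) :
    peelPt z ∈ KZ.cube ((n + m) + 1) := by
  intro k
  induction k using Fin.lastCases with
  | last =>
    simp only [peelPt, Fin.snoc_last]
    have h1 : 0 ≤ wScale z ∧ wScale z ≤ 1 := hz _
    have h2 : 0 ≤ wX z 0 ∧ wX z 0 ≤ 1 := hz _
    exact ⟨mul_nonneg h1.1 h2.1, mul_le_one₀ h1.2 h2.1 h2.2⟩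
  | cast k =>
    simp only [peelPt, Fin.snoc_castSucc]
    induction k using Fin.addCases with
    | left j => simp only [Fin.append_left]; exact hz _
    | right j => simp only [Fin.append_right]; exact hz _

/-- The scaled variables peel: `u_{i+1}(z) = uᵢ(peelPt z)`. [folklore] -/
theorem uR_succ {n : ℕ} (c : ℚ) (z : Fin (((n + 1) + m) + 1) → ℝ) (i : Fin n) :
    uR c (wScale z) (wX z) i.succ = uR c (wScale (peelPt z)) (wX (peelPt z)) i := by
  simp only [uR, wScale_peelPt]
  rw [Finset.prod_filter, Finset.prod_filter, Fin.prod_univ_succ]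
  simp only [Fin.zero_le, if_true, wX_peelPt]
  have : ∀ j : Fin n, (if j.succ ≤ i.succ then wX z j.succ else 1) = if j ≤ i then wX z j.succ else 1 := by
    intro j; simp [Fin.succ_le_succ_iff]
  simp only [this]
  ring

/-- The first scaled variable is `c̄ τ x₀`. [folklore] -/
theorem uR_zero {n : ℕ} (c : ℚ) (τ : ℝ) (x : Fin (n + 1) → ℝ) : uR c τ x 0 = c * τ * x 0 := by
  simp only [uR]
  have : Finset.univ.filter (fun j : Fin (n + 1) => j ≤ 0) = {0} := by
    ext j; simp
  rw [this, Finset.prod_singleton]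

/-- **Value of `Z` on a one-letter word.** [folklore] -/
theorem fn_Zw_singleton {ι : Type} (c : ℚ) (hc : 0 ≤ c) (d : ι → Letter m) (hd : ∀ a, (d a).IsRegular c) (a : ι)
    (z : Fin ((1 + m) + 1) → ℝ) :
    (Zw c hc d hd [a]).fn z = (d a).lastR (wRider z) (c * wScale z * wX z 0) := by
  have hfilt : Finset.univ.filter (fun i : Fin 1 => i.val + 1 < 1) = ∅ := by
    ext i; simp
  simp only [Zw, RFun.fn, List.length_singleton]
  rw [hfilt, Finset.prod_empty, one_mul, Fin.prod_univ_one, List.getLast?_singleton]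
  simp only [List.get_cons_zero]
  cases d a with
  | inv => simp
  | reg N M =>
    simp only [Letter.lastNum_reg, Letter.cfDen_reg, Letter.lastR_reg, map_add, map_mul]
    rw [aeval_emb, aeval_emb, aeval_uMon, uR_zero]

/-- **Peeling the first letter of `Z`.** For `v = a :: v'` with `v'` non-empty and `z` in the cube,
`Z_v(x₀, x'; s; τ) = c_{d a}(c̄ τ x₀) · Z_{v'}(x'; s; τ x₀)`. [folklore] -/
theorem fn_Zw_cons {ι : Type} (c : ℚ) (hc : 0 ≤ c) (d : ι → Letter m) (hd : ∀ a, (d a).IsRegular c) (a : ι)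
    (v : List ι) (hv0 : v ≠ []) (z : Fin (((v.length + 1) + m) + 1) → ℝ)
    (hz : z ∈ KZ.cube (((v.length + 1) + m) + 1)) :
    (Zw c hc d hd (a :: v)).fn z = (d a).cR (wRider z) (c * wScale z * wX z 0) * (Zw c hc d hd v).fn (peelPt z) := by
  have hlast : (a :: v).getLast? = v.getLast? := by
    obtain ⟨b, l, rfl⟩ := List.exists_cons_of_ne_nil hv0
    simp [List.getLast?_cons_cons]
  have hnum : ∀ w : Fin (((v.length + 1) + m) + 1) → ℝ, ∀ (ℓ' : Letter m),
      aeval w (ℓ'.lastNum (n := v.length + 1)) = aeval (peelPt w) (ℓ'.lastNum (n := v.length)) := by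
    intro w ℓ'
    cases ℓ' with
    | inv => simp
    | reg N M => simp only [Letter.lastNum_reg, aeval_emb, wRider_peelPt]
  have hcfNum : ∀ (i : Fin v.length) (ℓ' : Letter m),
      aeval z (ℓ'.cfNum (uMon c (v.length + 1) m i.succ)) = aeval (peelPt z) (ℓ'.cfNum (uMon c v.length m i)) := by
    intro i ℓ'
    cases ℓ' with
    | inv => simp
    | reg N M => simp only [Letter.cfNum_reg, map_mul, aeval_emb, wRider_peelPt, aeval_uMon, uR_succ]
  have hcfDen : ∀ (i : Fin v.length) (ℓ' : Letter m),
      aeval z (ℓ'.cfDen (uMon c (v.length + 1) m i.succ)) = aeval (peelPt z) (ℓ'.cfDen (uMon c v.length m i)) := by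
    intro i ℓ'
    cases ℓ' with
    | inv => simp
    | reg N M => simp only [Letter.cfDen_reg, map_add, map_mul, aeval_emb, wRider_peelPt, aeval_uMon, uR_succ]
  -- the head factor
  have hhead : (d a).cR (wRider z) (c * wScale z * wX z 0) =
      aeval z ((d a).cfNum (uMon c (v.length + 1) m 0)) / aeval z ((d a).cfDen (uMon c (v.length + 1) m 0)) := by
    cases d a with
    | inv => simp
    | reg N M => simp only [Letter.cR_reg, Letter.cfNum_reg, Letter.cfDen_reg, map_add, map_mul, aeval_emb, aeval_uMon, uR_zero]
  -- split the filtered numerator product and the denominator product at the head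
  have hsplitN : (∏ i ∈ Finset.univ.filter (fun i : Fin (v.length + 1) => i.val + 1 < v.length + 1),
        aeval z ((d ((a :: v).get i)).cfNum (uMon c (v.length + 1) m i))) =
      aeval z ((d a).cfNum (uMon c (v.length + 1) m 0)) *
        ∏ i ∈ Finset.univ.filter (fun i : Fin v.length => i.val + 1 < v.length),
          aeval (peelPt z) ((d (v.get i)).cfNum (uMon c v.length m i)) := by
    rw [Finset.prod_filter, Finset.prod_filter, Fin.prod_univ_succ]
    have h0 : ((0 : Fin (v.length + 1)).val + 1 < v.length + 1) := by
      simp; exact List.length_pos_iff.2 hv0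
    rw [if_pos h0]
    congr 1
    refine Finset.prod_congr rfl fun i _ => ?_
    have : ((i.succ : Fin (v.length + 1)).val + 1 < v.length + 1) ↔ (i.val + 1 < v.length) := by simp
    simp only [this, List.get_cons_succ', hcfNum]
  have hsplitD : (∏ i : Fin (v.length + 1), aeval z ((d ((a :: v).get i)).cfDen (uMon c (v.length + 1) m i))) =
      aeval z ((d a).cfDen (uMon c (v.length + 1) m 0)) *
        ∏ i : Fin v.length, aeval (peelPt z) ((d (v.get i)).cfDen (uMon c v.length m i)) := by
    rw [Fin.prod_univ_succ]
    congr 1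
    refine Finset.prod_congr rfl fun i _ => ?_
    simp only [List.get_cons_succ', hcfDen]
  have hden0 : aeval z ((d a).cfDen (uMon c (v.length + 1) m 0)) ≠ 0 :=
    (d a).aeval_cfDen_ne hc (hd a) 0 hz
  have hdenT : ∏ i : Fin v.length, aeval (peelPt z) ((d (v.get i)).cfDen (uMon c v.length m i)) ≠ 0 := by
    have h := (Zw c hc d hd v).den_ne (peelPt z) (peelPt_mem hz)
    simpa only [Zw, map_prod] using h
  simp only [RFun.fn, Zw, List.length_cons, map_mul, map_prod]
  rw [hsplitN, hsplitD, hhead, hlast]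
  rcases v.getLast? with _ | a'
  · simp only [map_one]
    field_simp
  · simp only [hnum z (d a')]
    field_simp

end Words

/-! ## Families: substituting the scale by a rider polynomial, and the rider Stokes move -/

end Literature.NumberTheory.Transcendental.KZ.Cube

namespace Literature.NumberTheory.Transcendental.KZ

variable {M M' m n k N : ℕ}



namespace RFun

/-- Reading a function of `M` variables on `n + M` variables (the LAST `M`). [folklore] -/
def pre (n : ℕ) (T : RFun M) : RFun (n + M) :=
  ⟨MvPolynomial.rename (Fin.natAdd n) T.num, MvPolynomial.rename (Fin.natAdd n) T.den, fun y hy => by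
    rw [aeval_rename]; exact T.den_ne _ fun i => hy _⟩

/-- Value of `pre`. [folklore] -/
theorem fn_pre (n : ℕ) (T : RFun M) (y : Fin (n + M) → ℝ) : (T.pre n).fn y = T.fn (fun i => y (Fin.natAdd n i)) := by
  simp only [fn, pre, aeval_rename]; rfl

/-- `pre` is `liftN` followed by the block flip. [folklore] -/
theorem pre_eq_rename_liftN (n : ℕ) (T : RFun M) : T.pre n = (T.liftN n).rename finAddFlip := by
  have h : (finAddFlip ∘ Fin.castAdd n : Fin M → Fin (n + M)) = Fin.natAdd n := by
    funext i; simp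
  simp only [pre, liftN, rename, rename_rename, h]

end RFun

end Literature.NumberTheory.Transcendental.KZ

namespace Literature.NumberTheory.Transcendental.KZ.Cube

variable {M N : ℕ}

section Families

variable {M m n k : ℕ}

/-- The point of the word layout read by a family: word coordinates, letter riders, and the scale
replaced by the value of the rider polynomial `π`. [folklore] -/
def famPt (n : ℕ) (π : MvPolynomial (Fin (m + k)) ℚ) (y : Fin (n + (m + k)) → ℝ) : Fin ((n + m) + 1) → ℝ :=
  Fin.snoc (Fin.append (fun j : Fin n => y (Fin.castAdd (m + k) j)) (fun j : Fin m => y (Fin.natAdd n (Fin.castAdd k j))))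
    (aeval (fun i => y (Fin.natAdd n i)) π)

/-- The substitution realising `famPt`. [folklore] -/
def famSubst (n : ℕ) (π : MvPolynomial (Fin (m + k)) ℚ) : Fin ((n + m) + 1) → MvPolynomial (Fin (n + (m + k))) ℚ :=
  Fin.lastCases (MvPolynomial.rename (Fin.natAdd n) π)
    (Fin.addCases (fun j : Fin n => X (Fin.castAdd (m + k) j)) (fun j : Fin m => X (Fin.natAdd n (Fin.castAdd k j))))

/-- Evaluating the family substitution. [folklore] -/
theorem aeval_famSubst (π : MvPolynomial (Fin (m + k)) ℚ) (y : Fin (n + (m + k)) → ℝ) :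
    (fun i => aeval y (famSubst n π i)) = famPt n π y := by
  funext i
  induction i using Fin.lastCases with
  | last => simp [famSubst, famPt, aeval_rename]; rfl
  | cast i =>
    simp only [famSubst, famPt, Fin.lastCases_castSucc, Fin.snoc_castSucc]
    induction i using Fin.addCases with
    | left j => simp
    | right j => simp

/-- Word coordinates of a family point. [folklore] -/
@[simp] theorem wX_famPt (π : MvPolynomial (Fin (m + k)) ℚ) (y : Fin (n + (m + k)) → ℝ) (j : Fin n) :
    wX (famPt n π y) j = y (Fin.castAdd (m + k) j) := by
  simp [wX, famPt]

/-- Letter riders of a family point. [folklore] -/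
@[simp] theorem wRider_famPt (π : MvPolynomial (Fin (m + k)) ℚ) (y : Fin (n + (m + k)) → ℝ) (j : Fin m) :
    wRider (famPt n π y) j = y (Fin.natAdd n (Fin.castAdd k j)) := by
  show famPt n π y (Fin.castSucc (Fin.natAdd n j)) = _
  rw [famPt, Fin.snoc_castSucc, Fin.append_right]

/-- Scale of a family point. [folklore] -/
@[simp] theorem wScale_famPt (π : MvPolynomial (Fin (m + k)) ℚ) (y : Fin (n + (m + k)) → ℝ) :
    wScale (famPt n π y) = aeval (fun i => y (Fin.natAdd n i)) π := by
  simp [wScale, famPt]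

/-- A RIDER SCALE: a polynomial in the riders with values in `[0,1]` on the cube. [folklore] -/
def IsScale (π : MvPolynomial (Fin (m + k)) ℚ) : Prop :=
  ∀ e ∈ KZ.cube (m + k), 0 ≤ (aeval e π : ℝ) ∧ (aeval e π : ℝ) ≤ 1

/-- The riders of a cube point lie in the cube. [folklore] -/
theorem rider_mem_cube {y : Fin (n + (m + k)) → ℝ} (hy : y ∈ KZ.cube (n + (m + k))) :
    (fun i => y (Fin.natAdd n i)) ∈ KZ.cube (m + k) := fun _ => hy _

/-- A family point of a cube point lies in the cube. [folklore] -/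
theorem famPt_mem {π : MvPolynomial (Fin (m + k)) ℚ} (hπ : IsScale π) {y : Fin (n + (m + k)) → ℝ}
    (hy : y ∈ KZ.cube (n + (m + k))) : famPt n π y ∈ KZ.cube ((n + m) + 1) := by
  intro i
  induction i using Fin.lastCases with
  | last => simp only [famPt, Fin.snoc_last]; exact hπ _ (rider_mem_cube hy)
  | cast i =>
    simp only [famPt, Fin.snoc_castSucc]
    induction i using Fin.addCases with
    | left j => simp only [Fin.append_left]; exact hy _
    | right j => simp only [Fin.append_right]; exact hy _

/-- **The family of a word-layout function**: riders `(s, e) ∈ [0,1]^{m+k}`, scale `τ := π(s,e)`.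
[folklore] -/
def fam (T : RFun ((n + m) + 1)) (π : MvPolynomial (Fin (m + k)) ℚ) (hπ : IsScale π) : RFun (n + (m + k)) :=
  T.subst (famSubst n π) fun y hy => by rw [aeval_famSubst]; exact famPt_mem hπ hy

/-- Value of a family. [folklore] -/
theorem fn_fam (T : RFun ((n + m) + 1)) (π : MvPolynomial (Fin (m + k)) ℚ) (hπ : IsScale π)
    (y : Fin (n + (m + k)) → ℝ) : (fam T π hπ).fn y = T.fn (famPt n π y) := by
  rw [fam, RFun.fn_subst, aeval_famSubst]

/-- The family TERM `ρ(s,e) · T(x; s; π(s,e))` of a multiplier `ρ` (a regular rational function of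
the riders) and a word-layout function `T`. [folklore] -/
def famTerm (ρ : RFun (m + k)) (T : RFun ((n + m) + 1)) (π : MvPolynomial (Fin (m + k)) ℚ) (hπ : IsScale π) :
    RFun (n + (m + k)) :=
  (ρ.pre n).mul (fam T π hπ)

/-- Value of a family term. [folklore] -/
theorem fn_famTerm (ρ : RFun (m + k)) (T : RFun ((n + m) + 1)) (π : MvPolynomial (Fin (m + k)) ℚ) (hπ : IsScale π)
    (y : Fin (n + (m + k)) → ℝ) :
    (famTerm ρ T π hπ).fn y = ρ.fn (fun i => y (Fin.natAdd n i)) * T.fn (famPt n π y) := by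
  rw [famTerm, RFun.fn_mul, RFun.fn_pre, fn_fam]

/-- Extending a rider scale by the new homotopy rider: `π⁺(s, e, v) = π(s, e) · v`. [folklore] -/
def scaleMul (π : MvPolynomial (Fin (m + k)) ℚ) : MvPolynomial (Fin (m + (k + 1))) ℚ :=
  MvPolynomial.rename Fin.castSucc π * X (Fin.last (m + k))

/-- Evaluating the extended scale. [folklore] -/
theorem aeval_scaleMul (π : MvPolynomial (Fin (m + k)) ℚ) (e : Fin (m + (k + 1)) → ℝ) :
    aeval e (scaleMul π) = aeval (Fin.init e) π * e (Fin.last (m + k)) := by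
  simp only [scaleMul, map_mul, aeval_rename, aeval_X]; rfl

/-- The extended scale is a scale. [folklore] -/
theorem isScale_scaleMul {π : MvPolynomial (Fin (m + k)) ℚ} (hπ : IsScale π) : IsScale (scaleMul π) := by
  intro e he
  rw [aeval_scaleMul]
  have h1 := hπ (Fin.init e) fun i => he (Fin.castSucc i)
  have h2 : 0 ≤ e (Fin.last (m + k)) ∧ e (Fin.last (m + k)) ≤ 1 := he _
  exact ⟨mul_nonneg h1.1 h2.1, mul_le_one₀ h1.2 h2.1 h2.2⟩

/-- The family point over an extended rider block reads the original riders. [folklore] -/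
theorem famPt_scaleMul_snoc (π : MvPolynomial (Fin (m + k)) ℚ) (y : Fin (n + (m + k)) → ℝ) (v : ℝ) :
    famPt n (scaleMul π) (Fin.snoc y v : Fin (n + (m + k) + 1) → ℝ) =
      Fin.snoc (Fin.init (famPt n π y)) (aeval (fun i => y (Fin.natAdd n i)) π * v) := by
  funext i
  induction i using Fin.lastCases with
  | last =>
    simp only [famPt, Fin.snoc_last, Fin.init_snoc, aeval_scaleMul]
    have h1 : (Fin.init fun i : Fin (m + (k + 1)) => (Fin.snoc y v : Fin (n + (m + k) + 1) → ℝ) (Fin.natAdd n i)) =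
        fun i => y (Fin.natAdd n i) := by
      funext j
      show (Fin.snoc y v : Fin (n + (m + k) + 1) → ℝ) (Fin.castSucc (Fin.natAdd n j)) = _
      rw [Fin.snoc_castSucc]
    have h2 : (Fin.snoc y v : Fin (n + (m + k) + 1) → ℝ) (Fin.natAdd n (Fin.last (m + k))) = v := by
      show (Fin.snoc y v : Fin (n + (m + k) + 1) → ℝ) (Fin.last _) = v
      rw [Fin.snoc_last]
    rw [h1]
    simp only [h2]
  | cast i =>
    simp only [famPt, Fin.snoc_castSucc, Fin.init_snoc]
    induction i using Fin.addCases with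
    | left j =>
      simp only [Fin.append_left]
      show (Fin.snoc y v : Fin (n + (m + k) + 1) → ℝ) (Fin.castSucc (Fin.castAdd (m + k) j)) = _
      rw [Fin.snoc_castSucc]
    | right j =>
      simp only [Fin.append_right]
      show (Fin.snoc y v : Fin (n + (m + k) + 1) → ℝ) (Fin.castSucc (Fin.natAdd n (Fin.castAdd k j))) = _
      rw [Fin.snoc_castSucc]

end Families

/-! ## The rider Stokes move: a family equals the derivative family read one rider up -/

section RiderStokes

variable {R : Type} [CommRing R] {χ : KZ.FormalRep →+ R} (hrel : ∀ c ∈ KZ.relations, χ c = 0)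
include hrel

variable {m n k : ℕ}

/-- The SCALE DERIVATIVE `∂_τ(τ · T)` of a word-layout function. [folklore] -/
def scaleDeriv (T : RFun ((n + m) + 1)) : RFun ((n + m) + 1) :=
  ((RFun.poly (X (Fin.last (n + m)))).mul T).dlast

omit hrel in
/-- Value of the scale derivative at a cube point `(p, t₀)`: `T(p,t₀) + t₀ ∂_τT(p,t₀)`. [folklore] -/
theorem fn_scaleDeriv (T : RFun ((n + m) + 1)) {p : Fin (n + m) → ℝ} (hp : p ∈ KZ.cube (n + m)) {t₀ : ℝ}
    (ht₀ : t₀ ∈ Icc (0 : ℝ) 1) :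
    (scaleDeriv T).fn (Fin.snoc p t₀) = T.fn (Fin.snoc p t₀) + t₀ * T.dlast.fn (Fin.snoc p t₀) := by
  set U : RFun ((n + m) + 1) := (RFun.poly (X (Fin.last (n + m)))).mul T with hU
  have h1 : HasDerivAt (fun t : ℝ => U.fn (Fin.snoc p t)) ((scaleDeriv T).fn (Fin.snoc p t₀)) t₀ :=
    U.hasDerivAt_fn_snoc hp ht₀
  have hfun : (fun t : ℝ => U.fn (Fin.snoc p t)) = fun t => t * T.fn (Fin.snoc p t) := by
    funext t; rw [hU, RFun.fn_mul, RFun.fn_poly, aeval_X, Fin.snoc_last]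
  rw [hfun] at h1
  have h2 : HasDerivAt (fun t : ℝ => t * T.fn (Fin.snoc p t)) (1 * T.fn (Fin.snoc p t₀) + t₀ * T.dlast.fn (Fin.snoc p t₀)) t₀ :=
    (hasDerivAt_id t₀).mul (T.hasDerivAt_fn_snoc hp ht₀)
  rw [h1.unique h2, one_mul]

/-- **The rider Stokes move.** For a multiplier `ρ` of the riders, a word-layout function `T` and
a rider scale `π`: `⟪ρ · T[τ:=π]⟫ = ⟪ρ · (∂_τ(τT))[τ := π·v]⟫`, the right side read with the new
rider `v ∈ [0,1]` — the Stokes move along `v` for `F = ρ · v · T[τ := πv]` (`F|_{v=1} = ρT[π]`,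
`F|_{v=0} = 0`, `∂_vF = ρ (∂_τ(τT))[πv]` by the chain rule). This is how the running endpoint of an
iterated integral is turned into one more integration variable without any factor `1/π`.
[cite: KontsevichZagier2001, §1.2 rule (3)] -/
theorem chi_famTerm_eq_scaleDeriv (ρ : RFun (m + k)) (T : RFun ((n + m) + 1)) (π : MvPolynomial (Fin (m + k)) ℚ)
    (hπ : IsScale π) :
    (famTerm ρ T π hπ).chi χ =
      (famTerm (k := k + 1) ρ.lift (scaleDeriv T) (scaleMul π) (isScale_scaleMul hπ)).chi χ := by
  have hπ' := isScale_scaleMul hπ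
  -- the homotopy `F(y, v) = ρ(y) · v · T(famPt π⁺ (y,v))`
  set F : RFun ((n + (m + k)) + 1) :=
    ((ρ.pre n).lift).mul ((RFun.poly (X (Fin.last (n + (m + k))))).mul (fam T (scaleMul π) hπ')) with hF
  have hst := RFun.chi_stokesAt hrel (Fin.last _) F
  -- values of `F` on vertical fibres
  have hFval : ∀ (y : Fin (n + (m + k)) → ℝ) (v : ℝ), F.fn (Fin.snoc y v) =
      ρ.fn (fun i => y (Fin.natAdd n i)) * (v * T.fn (Fin.snoc (Fin.init (famPt n π y))
        (aeval (fun i => y (Fin.natAdd n i)) π * v))) := by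
    intro y v
    rw [hF, RFun.fn_mul, RFun.fn_lift_snoc, RFun.fn_pre, RFun.fn_mul, RFun.fn_poly, aeval_X, Fin.snoc_last, fn_fam,
      famPt_scaleMul_snoc]
  -- face `v = 1`
  have e1 : (F.faceAt (Fin.last _) 1 ⟨zero_le_one, le_rfl⟩).chi χ = (famTerm ρ T π hπ).chi χ := by
    refine RFun.chi_congr hrel fun y _ => ?_
    rw [RFun.fn_faceAt, Fin.insertNth_last', fn_famTerm]
    push_cast
    rw [hFval, mul_one, one_mul, ← wScale_famPt π y, wScale, Fin.snoc_init_self]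
  -- face `v = 0`
  have e0 : (F.faceAt (Fin.last _) 0 ⟨le_rfl, zero_le_one⟩).chi χ = 0 := by
    refine RFun.chi_eq_zero hrel fun y _ => ?_
    rw [RFun.fn_faceAt, Fin.insertNth_last']
    push_cast
    rw [hFval, zero_mul, mul_zero]
  -- the derivative
  have ed : (F.pd (Fin.last _)).chi χ =
      (famTerm (k := k + 1) ρ.lift (scaleDeriv T) (scaleMul π) hπ').chi χ := by
    refine RFun.chi_congr hrel fun w hw => ?_
    -- write `w = snoc y v`
    have hw' : w = Fin.snoc (Fin.init w) (w (Fin.last _)) := (Fin.snoc_init_self w).symm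
    set y : Fin (n + (m + k)) → ℝ := Fin.init w with hy_def
    set v : ℝ := w (Fin.last _) with hv_def
    have hy : y ∈ KZ.cube (n + (m + k)) := fun i => hw (Fin.castSucc i)
    have hv : v ∈ Icc (0 : ℝ) 1 := ⟨(hw _).1, (hw _).2⟩
    rw [hw']
    -- data
    set r : Fin (m + k) → ℝ := fun i => y (Fin.natAdd n i) with hr
    set p : Fin (n + m) → ℝ := Fin.init (famPt n π y) with hp_def
    set a : ℝ := aeval r π with ha_def
    have hr_mem : r ∈ KZ.cube (m + k) := rider_mem_cube hy
    have hp : p ∈ KZ.cube (n + m) := fun i => famPt_mem hπ hy (Fin.castSucc i)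
    have ha : 0 ≤ a ∧ a ≤ 1 := hπ r hr_mem
    have hav : a * v ∈ Icc (0 : ℝ) 1 := ⟨mul_nonneg ha.1 hv.1, mul_le_one₀ ha.2 hv.1 hv.2⟩
    -- LHS: the actual `v`-derivative of `F`
    have hL : HasDerivAt (fun s : ℝ => F.fn (Fin.snoc y s)) ((F.pd (Fin.last _)).fn (Fin.snoc y v)) v := by
      rw [RFun.pd_last]; exact F.hasDerivAt_fn_snoc hy hv
    have hfunF : (fun s : ℝ => F.fn (Fin.snoc y s)) = fun s => ρ.fn r * (s * T.fn (Fin.snoc p (a * s))) := by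
      funext s; rw [hFval]
    rw [hfunF] at hL
    have hT : HasDerivAt (fun t : ℝ => T.fn (Fin.snoc p t)) (T.dlast.fn (Fin.snoc p (a * v))) (a * v) :=
      T.hasDerivAt_fn_snoc hp hav
    have hcomp : HasDerivAt (fun s : ℝ => T.fn (Fin.snoc p (a * s))) (T.dlast.fn (Fin.snoc p (a * v)) * a) v := by
      have ha' : HasDerivAt (fun s : ℝ => a * s) a v := by simpa using (hasDerivAt_id v).const_mul a
      exact hT.comp v ha'
    have hR : HasDerivAt (fun s : ℝ => ρ.fn r * (s * T.fn (Fin.snoc p (a * s))))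
        (ρ.fn r * (1 * T.fn (Fin.snoc p (a * v)) + v * (T.dlast.fn (Fin.snoc p (a * v)) * a))) v :=
      ((hasDerivAt_id v).mul hcomp).const_mul (ρ.fn r)
    rw [hL.unique hR]
    -- RHS value
    rw [fn_famTerm, RFun.fn_lift]
    have hinit : (Fin.init fun i : Fin (m + (k + 1)) => (Fin.snoc y v : Fin (n + (m + k) + 1) → ℝ) (Fin.natAdd n i)) = r := by
      funext j
      show (Fin.snoc y v : Fin (n + (m + k) + 1) → ℝ) (Fin.castSucc (Fin.natAdd n j)) = _
      rw [Fin.snoc_castSucc]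
    rw [hinit, famPt_scaleMul_snoc, fn_scaleDeriv T hp hav]
    ring
  rw [← e1, ← ed, hst, e0, sub_zero]

end RiderStokes

/-! ## Euler homogeneity from peeling, and the Stokes move along the first word coordinate -/

end Literature.NumberTheory.Transcendental.KZ.Cube

namespace Literature.NumberTheory.Transcendental.KZ

variable {M M' m n k N : ℕ}



namespace RFun

/-- Derivative of a regular rational function along any coordinate at a cube point. [folklore] -/
theorem hasDerivAt_fn_update (T : RFun M) {y : Fin M → ℝ} (hy : y ∈ KZ.cube M) (i : Fin M) :
    HasDerivAt (fun t : ℝ => T.fn (Function.update y i t)) ((T.pd i).fn y) (y i) := by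
  have hQ : aeval (Function.update y i (y i)) T.den ≠ 0 := by
    rw [Function.update_eq_self]; exact T.den_ne y hy
  have h := hasDerivAt_aeval_div_aeval_update T.num T.den y i (y i) hQ
  simp only [Function.update_eq_self] at h
  have hval : (T.pd i).fn y = (aeval y (pderiv i T.num) * aeval y T.den - aeval y T.num * aeval y (pderiv i T.den)) /
      aeval y T.den ^ 2 := by
    simp only [fn, pd, map_sub, map_mul, map_pow]
  rw [hval]
  exact h

end RFun

end Literature.NumberTheory.Transcendental.KZ

namespace Literature.NumberTheory.Transcendental.KZ.Cube

variable {M N : ℕ}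

section EulerPeel

variable {M m n k : ℕ}

/-- The index of the first word coordinate in the word layout. [folklore] -/
def ix0 (n m : ℕ) : Fin (((n + 1) + m) + 1) := Fin.castSucc (Fin.castAdd m 0)

/-- The EULER derivative `∂_{x₀}(x₀ · T)` along the first word coordinate. [folklore] -/
def eulerX0 (T : RFun (((n + 1) + m) + 1)) : RFun (((n + 1) + m) + 1) :=
  ((RFun.poly (X (ix0 n m))).mul T).pd (ix0 n m)

/-- Updating the scale of a word-layout point. [folklore] -/
theorem peelPt_update_scale (z : Fin (((n + 1) + m) + 1) → ℝ) (t : ℝ) :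
    peelPt (Function.update z (Fin.last _) t) = Fin.snoc (Fin.init (peelPt z)) (t * wX z 0) := by
  funext i
  induction i using Fin.lastCases with
  | last =>
    simp only [peelPt, Fin.snoc_last, Fin.init_snoc, wScale, Function.update_self, wX]
    rw [Function.update_of_ne (Fin.castSucc_lt_last _).ne]
  | cast i =>
    simp only [peelPt, Fin.snoc_castSucc, Fin.init_snoc]
    induction i using Fin.addCases with
    | left j => simp only [Fin.append_left, wX]; rw [Function.update_of_ne (Fin.castSucc_lt_last _).ne]
    | right j => simp only [Fin.append_right, wRider]; rw [Function.update_of_ne (Fin.castSucc_lt_last _).ne]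

/-- Updating the first word coordinate of a word-layout point. [folklore] -/
theorem peelPt_update_x0 (z : Fin (((n + 1) + m) + 1) → ℝ) (w : ℝ) :
    peelPt (Function.update z (ix0 n m) w) = Fin.snoc (Fin.init (peelPt z)) (wScale z * w) := by
  have hne_last : (Fin.last ((n + 1) + m)) ≠ ix0 n m := (Fin.castSucc_lt_last _).ne'
  funext i
  induction i using Fin.lastCases with
  | last =>
    simp only [peelPt, Fin.snoc_last, Fin.init_snoc, wScale, wX]
    rw [Function.update_of_ne hne_last]
    simp only [ix0, Function.update_self]
  | cast i =>
    simp only [peelPt, Fin.snoc_castSucc, Fin.init_snoc]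
    induction i using Fin.addCases with
    | left j =>
      simp only [Fin.append_left, wX, ix0]
      rw [Function.update_of_ne]
      intro h
      have := Fin.castSucc_injective _ h
      have := Fin.castAdd_injective _ _ this
      exact Fin.succ_ne_zero j this
    | right j =>
      simp only [Fin.append_right, wRider, ix0]
      rw [Function.update_of_ne]
      intro h
      have h' := congrArg Fin.val h
      simp at h'

/-- **Euler homogeneity from peeling.** If `T(z) = P(peelPt z)` on the cube, then
`∂_τ(τ T) = ∂_{x₀}(x₀ T)` on the cube (both equal `φ + τ x₀ φ'` for `φ(σ) = P(…, σ)`).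
[folklore] -/
theorem fn_scaleDeriv_eq_eulerX0 (T : RFun (((n + 1) + m) + 1)) (P : RFun ((n + m) + 1))
    (hpeel : ∀ z ∈ KZ.cube (((n + 1) + m) + 1), T.fn z = P.fn (peelPt z))
    {z : Fin (((n + 1) + m) + 1) → ℝ} (hz : z ∈ KZ.cube (((n + 1) + m) + 1)) :
    (scaleDeriv T).fn z = (eulerX0 T).fn z := by
  -- notation
  set τ₀ : ℝ := wScale z with hτ₀
  set x₀ : ℝ := wX z 0 with hx₀
  set q : Fin (n + m) → ℝ := Fin.init (peelPt z) with hq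
  have hτ : τ₀ ∈ Icc (0 : ℝ) 1 := ⟨(hz _).1, (hz _).2⟩
  have hx : x₀ ∈ Icc (0 : ℝ) 1 := ⟨(hz _).1, (hz _).2⟩
  have hqmem : q ∈ KZ.cube (n + m) := fun i => peelPt_mem hz (Fin.castSucc i)
  have hprod : τ₀ * x₀ ∈ Icc (0 : ℝ) 1 := ⟨mul_nonneg hτ.1 hx.1, mul_le_one₀ hτ.2 hx.1 hx.2⟩
  set φ : ℝ → ℝ := fun σ => P.fn (Fin.snoc q σ) with hφ
  have hφ' : HasDerivAt φ (P.dlast.fn (Fin.snoc q (τ₀ * x₀))) (τ₀ * x₀) := P.hasDerivAt_fn_snoc hqmem hprod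
  set D : ℝ := P.dlast.fn (Fin.snoc q (τ₀ * x₀)) with hD
  -- (1) the scale side: `t ↦ (τ T)(z[τ := t]) = t φ(t x₀)` on `[0,1]`
  have hzlast : z (Fin.last _) = τ₀ := rfl
  have hS1 : HasDerivWithinAt (fun t : ℝ => ((RFun.poly (X (Fin.last ((n + 1) + m)))).mul T).fn (Function.update z (Fin.last _) t))
      ((scaleDeriv T).fn z) (Icc 0 1) τ₀ := by
    have h := ((RFun.poly (X (Fin.last ((n + 1) + m)))).mul T).hasDerivAt_fn_update hz (Fin.last _)
    rw [hzlast] at h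
    exact h.hasDerivWithinAt
  have hS2 : HasDerivWithinAt (fun t : ℝ => t * φ (t * x₀)) (1 * φ (τ₀ * x₀) + τ₀ * (D * x₀)) (Icc 0 1) τ₀ := by
    have hc : HasDerivAt (fun t : ℝ => φ (t * x₀)) (D * x₀) τ₀ := by
      have hl : HasDerivAt (fun t : ℝ => t * x₀) x₀ τ₀ := by simpa using (hasDerivAt_id τ₀).mul_const x₀
      exact hφ'.comp τ₀ hl
    exact ((hasDerivAt_id τ₀).mul hc).hasDerivWithinAt
  have hS : (scaleDeriv T).fn z = 1 * φ (τ₀ * x₀) + τ₀ * (D * x₀) := by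
    refine (uniqueDiffOn_Icc zero_lt_one τ₀ hτ).eq_deriv _ hS1 (hS2.congr (fun t ht => ?_) ?_)
    · have hzt : Function.update z (Fin.last _) t ∈ KZ.cube (((n + 1) + m) + 1) :=
        KZ.update_mem_cube hz _ ht.1 ht.2
      rw [RFun.fn_mul, RFun.fn_poly, aeval_X, Function.update_self, hpeel _ hzt, peelPt_update_scale]
    · have hupd : Function.update z (Fin.last _) τ₀ = z := Function.update_eq_self _ _
      have hlastp : peelPt z (Fin.last _) = τ₀ * x₀ := wScale_peelPt z
      rw [hupd, RFun.fn_mul, RFun.fn_poly, aeval_X, hpeel z hz]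
      conv_lhs => rw [← Fin.snoc_init_self (peelPt z), hlastp]
      rfl
  -- (2) the `x₀` side: `w ↦ (x₀ T)(z[x₀ := w]) = w φ(τ₀ w)` on `[0,1]`
  have hz0 : z (ix0 n m) = x₀ := rfl
  have hE1 : HasDerivWithinAt (fun w : ℝ => ((RFun.poly (X (ix0 n m))).mul T).fn (Function.update z (ix0 n m) w))
      ((eulerX0 T).fn z) (Icc 0 1) x₀ := by
    have h := ((RFun.poly (X (ix0 n m))).mul T).hasDerivAt_fn_update hz (ix0 n m)
    rw [hz0] at h
    exact h.hasDerivWithinAt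
  have hE2 : HasDerivWithinAt (fun w : ℝ => w * φ (τ₀ * w)) (1 * φ (τ₀ * x₀) + x₀ * (D * τ₀)) (Icc 0 1) x₀ := by
    have hc : HasDerivAt (fun w : ℝ => φ (τ₀ * w)) (D * τ₀) x₀ := by
      have hl : HasDerivAt (fun w : ℝ => τ₀ * w) τ₀ x₀ := by simpa using (hasDerivAt_id x₀).const_mul τ₀
      exact hφ'.comp x₀ hl
    exact ((hasDerivAt_id x₀).mul hc).hasDerivWithinAt
  have hE : (eulerX0 T).fn z = 1 * φ (τ₀ * x₀) + x₀ * (D * τ₀) := by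
    refine (uniqueDiffOn_Icc zero_lt_one x₀ hx).eq_deriv _ hE1 (hE2.congr (fun w hw => ?_) ?_)
    · have hzw : Function.update z (ix0 n m) w ∈ KZ.cube (((n + 1) + m) + 1) :=
        KZ.update_mem_cube hz _ hw.1 hw.2
      rw [RFun.fn_mul, RFun.fn_poly, aeval_X, Function.update_self, hpeel _ hzw, peelPt_update_x0]
    · have hupd : Function.update z (ix0 n m) x₀ = z := Function.update_eq_self _ _
      have hlastp : peelPt z (Fin.last _) = τ₀ * x₀ := wScale_peelPt z
      rw [hupd, RFun.fn_mul, RFun.fn_poly, aeval_X, hpeel z hz]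
      conv_lhs => rw [← Fin.snoc_init_self (peelPt z), hlastp]
      rfl
  rw [hS, hE]; ring

end EulerPeel

/-! ## Head and last factors; peeling in `RFun` form; the face `x₀ = c` -/

section PeelF

variable {m n k : ℕ}

/-- The HEAD FACTOR `c_ℓ(c̄ τ)` of a letter as a word-layout function (of the scale only).
[folklore] -/
def headF (c : ℚ) (hc : 0 ≤ c) (ℓ : Letter m) (hℓ : ℓ.IsRegular c) : RFun ((n + m) + 1) :=
  match ℓ, hℓ with
  | Letter.inv, _ => RFun.const 1
  | Letter.reg N M, hℓ =>
    ⟨Letter.emb n N * (C c * X (Fin.last (n + m))), Letter.emb n N * (C c * X (Fin.last (n + m))) + Letter.emb n M,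
      fun z hz => by
        have hτ : 0 ≤ wScale z ∧ wScale z ≤ 1 := hz _
        have hc' : (0 : ℝ) ≤ c := by exact_mod_cast hc
        simp only [map_add, map_mul, aeval_emb, MvPolynomial.aeval_C, aeval_X, eq_ratCast]
        have h := hℓ _ (wRider_mem hz) (c * wScale z) (mul_nonneg hc' hτ.1)
          (by simpa using mul_le_mul_of_nonneg_left hτ.2 hc')
        convert h using 2
        simp [wScale]⟩

/-- The LAST FACTOR `last_ℓ(c̄ τ)` of a letter as a word-layout function. [folklore] -/
def lastF (c : ℚ) (hc : 0 ≤ c) (ℓ : Letter m) (hℓ : ℓ.IsRegular c) : RFun ((n + m) + 1) :=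
  match ℓ, hℓ with
  | Letter.inv, _ => RFun.const 1
  | Letter.reg N M, hℓ =>
    ⟨Letter.emb n N, Letter.emb n N * (C c * X (Fin.last (n + m))) + Letter.emb n M,
      fun z hz => by
        have hτ : 0 ≤ wScale z ∧ wScale z ≤ 1 := hz _
        have hc' : (0 : ℝ) ≤ c := by exact_mod_cast hc
        simp only [map_add, map_mul, aeval_emb, MvPolynomial.aeval_C, aeval_X, eq_ratCast]
        have h := hℓ _ (wRider_mem hz) (c * wScale z) (mul_nonneg hc' hτ.1)
          (by simpa using mul_le_mul_of_nonneg_left hτ.2 hc')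
        convert h using 2
        simp [wScale]⟩

/-- Value of the head factor. [folklore] -/
theorem fn_headF (c : ℚ) (hc : 0 ≤ c) (ℓ : Letter m) (hℓ : ℓ.IsRegular c) (z : Fin ((n + m) + 1) → ℝ) :
    (headF (n := n) c hc ℓ hℓ).fn z = ℓ.cR (wRider z) (c * wScale z) := by
  cases ℓ with
  | inv => simp [headF]
  | reg N M =>
    simp only [headF, RFun.fn, Letter.cR_reg, map_add, map_mul, aeval_emb, MvPolynomial.aeval_C, aeval_X,
      eq_ratCast, wScale]

/-- Value of the last factor. [folklore] -/
theorem fn_lastF (c : ℚ) (hc : 0 ≤ c) (ℓ : Letter m) (hℓ : ℓ.IsRegular c) (z : Fin ((n + m) + 1) → ℝ) :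
    (lastF (n := n) c hc ℓ hℓ).fn z = ℓ.lastR (wRider z) (c * wScale z) := by
  cases ℓ with
  | inv => simp [lastF]
  | reg N M =>
    simp only [lastF, RFun.fn, Letter.lastR_reg, map_add, map_mul, aeval_emb, MvPolynomial.aeval_C, aeval_X,
      eq_ratCast, wScale]

/-- The PEELED FUNCTION of a word `a :: v'`: `last_{d a}` if `v' = []`, else `c_{d a} · Z_{v'}`.
[folklore] -/
def peelF {ι : Type} (c : ℚ) (hc : 0 ≤ c) (d : ι → Letter m) (hd : ∀ a, (d a).IsRegular c) (a : ι) (v : List ι) :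
    RFun ((v.length + m) + 1) :=
  if v = [] then lastF c hc (d a) (hd a) else (headF c hc (d a) (hd a)).mul (Zw c hc d hd v)

/-- **Peeling in `RFun` form**: `Z_{a v'}(z) = peelF(peelPt z)` on the cube. [folklore] -/
theorem fn_Zw_eq_peelF {ι : Type} (c : ℚ) (hc : 0 ≤ c) (d : ι → Letter m) (hd : ∀ a, (d a).IsRegular c) (a : ι)
    (v : List ι) (z : Fin (((v.length + 1) + m) + 1) → ℝ) (hz : z ∈ KZ.cube (((v.length + 1) + m) + 1)) :
    (Zw c hc d hd (a :: v)).fn z = (peelF c hc d hd a v).fn (peelPt z) := by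
  by_cases h0 : v = []
  · subst h0
    rw [peelF, if_pos rfl, fn_lastF, fn_Zw_singleton, wRider_peelPt, wScale_peelPt, mul_assoc]
  · rw [peelF, if_neg h0, RFun.fn_mul, fn_headF, fn_Zw_cons c hc d hd a v h0 z hz, wRider_peelPt, wScale_peelPt,
      mul_assoc]

/-! ### Inserting a value as the first word coordinate -/

/-- The arity identity of removing the first word coordinate. [folklore] -/
theorem succ_add_eq (n m : ℕ) : (n + 1) + m = (n + m) + 1 := Nat.succ_add n m

/-- Insert the value `c` as the first word coordinate of a word-layout point. [folklore] -/
def x0cons (c : ℝ) (z' : Fin ((n + m) + 1) → ℝ) : Fin (((n + 1) + m) + 1) → ℝ :=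
  Fin.insertNth (ix0 n m) c fun j => z' (finCongr (succ_add_eq n m) j)

/-- The inserted coordinate. [folklore] -/
@[simp] theorem x0cons_ix0 (c : ℝ) (z' : Fin ((n + m) + 1) → ℝ) : x0cons c z' (ix0 n m) = c := by
  simp [x0cons]

/-- The other coordinates shift by one. [folklore] -/
theorem x0cons_apply_of_pos (c : ℝ) (z' : Fin ((n + m) + 1) → ℝ) (i : Fin (((n + 1) + m) + 1))
    (hi : 0 < (i : ℕ)) : x0cons c z' i = z' ⟨(i : ℕ) - 1, by omega⟩ := by
  have hk : i = (ix0 n m).succAbove ⟨(i : ℕ) - 1, by omega⟩ := by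
    rw [Fin.succAbove_of_le_castSucc]
    · apply Fin.ext; simp; omega
    · rw [Fin.le_def]; simp [ix0]
  conv_lhs => rw [hk]
  rw [x0cons, Fin.insertNth_apply_succAbove]
  simp only [finCongr_apply_mk]

/-- Peeling an inserted point: `peelPt (x0cons c z') = (init z', τ·c)`. [folklore] -/
theorem peelPt_x0cons (c : ℝ) (z' : Fin ((n + m) + 1) → ℝ) :
    peelPt (x0cons c z') = Fin.snoc (Fin.init z') (wScale z' * c) := by
  funext i
  induction i using Fin.lastCases with
  | last =>
    simp only [peelPt, Fin.snoc_last, wScale, wX]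
    rw [x0cons_apply_of_pos c z' _ (by simp), show (Fin.castSucc (Fin.castAdd m (0 : Fin (n + 1))) : Fin (((n + 1) + m) + 1)) =
      ix0 n m from rfl, x0cons_ix0]
    congr 2; apply Fin.ext; simp
  | cast i =>
    simp only [peelPt, Fin.snoc_castSucc, Fin.init]
    induction i using Fin.addCases with
    | left j =>
      simp only [Fin.append_left, wX]
      rw [x0cons_apply_of_pos c z' _ (by simp)]
      rfl
    | right j =>
      simp only [Fin.append_right, wRider]
      rw [x0cons_apply_of_pos c z' _ (by simp)]
      congr 1
      apply Fin.ext
      simp only [Fin.val_castSucc, Fin.val_natAdd]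
      omega

/-- An inserted point of a cube point with `c ∈ [0,1]` lies in the cube. [folklore] -/
theorem x0cons_mem {c : ℝ} (hc : c ∈ Icc (0 : ℝ) 1) {z' : Fin ((n + m) + 1) → ℝ} (hz' : z' ∈ KZ.cube ((n + m) + 1)) :
    x0cons c z' ∈ KZ.cube (((n + 1) + m) + 1) := by
  intro i
  by_cases hi : 0 < (i : ℕ)
  · rw [x0cons_apply_of_pos c z' i hi]; exact hz' _
  · have : i = ix0 n m := by
      apply Fin.ext
      rw [show ((ix0 n m : Fin (((n + 1) + m) + 1)) : ℕ) = 0 from rfl]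
      omega
    rw [this, x0cons_ix0]; exact hc

/-- The FACE `x₀ = c` of a word-layout function, in the word layout of one letter less. [folklore] -/
def faceX0 (c : ℚ) (hc : 0 ≤ c ∧ c ≤ 1) (T : RFun (((n + 1) + m) + 1)) : RFun ((n + m) + 1) :=
  (T.faceAt (ix0 n m) c hc).rename (finCongr (succ_add_eq n m))

/-- Value of the face `x₀ = c`. [folklore] -/
theorem fn_faceX0 (c : ℚ) (hc : 0 ≤ c ∧ c ≤ 1) (T : RFun (((n + 1) + m) + 1)) (z' : Fin ((n + m) + 1) → ℝ) :
    (faceX0 c hc T).fn z' = T.fn (x0cons c z') := by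
  rw [faceX0, RFun.fn_rename, RFun.fn_faceAt]; rfl

/-- **The faces of `x₀ · T` for a peeling function**: at `x₀ = 1` it is the peeled function, at
`x₀ = 0` it vanishes. [folklore] -/
theorem fn_faceX0_mul_of_peel (T : RFun (((n + 1) + m) + 1)) (P : RFun ((n + m) + 1))
    (hpeel : ∀ z ∈ KZ.cube (((n + 1) + m) + 1), T.fn z = P.fn (peelPt z))
    {z' : Fin ((n + m) + 1) → ℝ} (hz' : z' ∈ KZ.cube ((n + m) + 1)) :
    (faceX0 1 ⟨zero_le_one, le_rfl⟩ ((RFun.poly (X (ix0 n m))).mul T)).fn z' = P.fn z' ∧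
      (faceX0 0 ⟨le_rfl, zero_le_one⟩ ((RFun.poly (X (ix0 n m))).mul T)).fn z' = 0 := by
  constructor
  · rw [fn_faceX0, RFun.fn_mul, RFun.fn_poly, aeval_X]
    push_cast
    rw [x0cons_ix0, one_mul, hpeel _ (x0cons_mem ⟨zero_le_one, le_rfl⟩ hz'), peelPt_x0cons, mul_one]
    show P.fn (Fin.snoc (Fin.init z') (z' (Fin.last _))) = P.fn z'
    rw [Fin.snoc_init_self]
  · rw [fn_faceX0, RFun.fn_mul, RFun.fn_poly, aeval_X]
    push_cast
    rw [x0cons_ix0, zero_mul]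

end PeelF

/-! ## The Stokes move along `x₀` inside a family, and the (O)-step at the level of one word -/

section FamilyX0

variable {R : Type} [CommRing R] {χ : KZ.FormalRep →+ R} (hrel : ∀ c ∈ KZ.relations, χ c = 0)

variable {m n k : ℕ}

/-- `ix0` is the index `0`. [folklore] -/
theorem ix0_eq_zero : ix0 n m = 0 := Fin.ext rfl

/-- `x0cons` is `Fin.cons` up to the arity cast. [folklore] -/
theorem x0cons_eq_cons (c : ℝ) (z' : Fin ((n + m) + 1) → ℝ) :
    x0cons c z' = (Fin.cons c (fun j => z' (finCongr (succ_add_eq n m) j)) : Fin (((n + 1) + m) + 1) → ℝ) := by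
  rw [x0cons, ix0_eq_zero, Fin.insertNth_zero']

/-- The index of `x₀` in a family with `k + 1` extra riders. [folklore] -/
def i0f (n m k : ℕ) : Fin (((n + 1) + (m + k)) + 1) := 0

/-- A family point after updating `x₀` is the update of the family point. [folklore] -/
theorem famPt_update_x0 (π : MvPolynomial (Fin (m + (k + 1))) ℚ) (y : Fin ((n + 1) + (m + (k + 1))) → ℝ) (t : ℝ) :
    famPt (n + 1) π (Function.update y (i0f n m k) t) = Function.update (famPt (n + 1) π y) (ix0 n m) t := by
  have hword : ∀ j : Fin (n + 1), (Fin.castAdd (m + (k + 1)) j : Fin ((n + 1) + (m + (k + 1)))) = i0f n m k ↔ j = 0 := by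
    intro j
    constructor
    · intro h; apply Fin.ext; have := congrArg Fin.val h; simpa [i0f] using this
    · rintro rfl; apply Fin.ext; simp [i0f]
  have hrid : ∀ i : Fin (m + (k + 1)), (Fin.natAdd (n + 1) i : Fin ((n + 1) + (m + (k + 1)))) ≠ i0f n m k := by
    intro i h; have := congrArg Fin.val h; simp [i0f] at this
  have hriders : (fun i => Function.update y (i0f n m k) t (Fin.natAdd (n + 1) i)) = fun i => y (Fin.natAdd (n + 1) i) := by
    funext i; rw [Function.update_of_ne (hrid i)]
  funext i
  by_cases hi : i = ix0 n m
  · subst hi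
    rw [Function.update_self]
    show famPt (n + 1) π (Function.update y (i0f n m k) t) (Fin.castSucc (Fin.castAdd m 0)) = t
    rw [famPt, Fin.snoc_castSucc, Fin.append_left, (hword 0).2 rfl, Function.update_self]
  · rw [Function.update_of_ne hi]
    induction i using Fin.lastCases with
    | last => simp only [famPt, Fin.snoc_last, hriders]
    | cast i =>
      simp only [famPt, Fin.snoc_castSucc]
      induction i using Fin.addCases with
      | left j =>
        simp only [Fin.append_left]
        rw [Function.update_of_ne]
        intro h
        exact hi (by rw [(hword j).1 h]; rfl)
      | right j =>
        simp only [Fin.append_right]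
        rw [Function.update_of_ne]
        intro h; have := congrArg Fin.val h; simp [i0f] at this

/-- **`∂_{x₀}` commutes with taking the family.** [folklore] -/
theorem fn_pd_famTerm_x0 (ρ : RFun (m + (k + 1))) (T : RFun (((n + 1) + m) + 1)) (π : MvPolynomial (Fin (m + (k + 1))) ℚ)
    (hπ : IsScale π) {y : Fin ((n + 1) + (m + (k + 1))) → ℝ} (hy : y ∈ KZ.cube ((n + 1) + (m + (k + 1)))) :
    ((famTerm ρ T π hπ : RFun (((n + 1) + (m + k)) + 1)).pd (i0f n m k)).fn y =
      (famTerm ρ (T.pd (ix0 n m)) π hπ).fn y := by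
  set G : RFun (((n + 1) + (m + k)) + 1) := famTerm ρ T π hπ with hG
  have h1 : HasDerivAt (fun t : ℝ => G.fn (Function.update y (i0f n m k) t)) ((G.pd (i0f n m k)).fn y) (y (i0f n m k)) :=
    G.hasDerivAt_fn_update hy _
  set p : Fin (((n + 1) + m) + 1) → ℝ := famPt (n + 1) π y with hp
  set r : Fin (m + (k + 1)) → ℝ := fun i => y (Fin.natAdd (n + 1) i) with hr
  have hpmem : p ∈ KZ.cube (((n + 1) + m) + 1) := famPt_mem hπ hy
  have hrid : ∀ i : Fin (m + (k + 1)), (Fin.natAdd (n + 1) i : Fin ((n + 1) + (m + (k + 1)))) ≠ i0f n m k := by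
    intro i h; have := congrArg Fin.val h; simp [i0f] at this
  have hfun : (fun t : ℝ => G.fn (Function.update y (i0f n m k) t)) = fun t => ρ.fn r * T.fn (Function.update p (ix0 n m) t) := by
    funext t
    rw [hG, fn_famTerm, famPt_update_x0]
    congr 2
    funext i; exact Function.update_of_ne (hrid i) _ _
  rw [hfun] at h1
  have hp0 : p (ix0 n m) = y (i0f n m k) := by
    show famPt (n + 1) π y (Fin.castSucc (Fin.castAdd m 0)) = y (i0f n m k)
    rw [famPt, Fin.snoc_castSucc, Fin.append_left]
    rfl
  have h2 : HasDerivAt (fun t : ℝ => ρ.fn r * T.fn (Function.update p (ix0 n m) t))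
      (ρ.fn r * (T.pd (ix0 n m)).fn p) (y (i0f n m k)) := by
    rw [← hp0]; exact (T.hasDerivAt_fn_update hpmem _).const_mul _
  rw [h1.unique h2, fn_famTerm]

/-- The arity identity of a face of a family. [folklore] -/
theorem fam_arity_eq (n m k : ℕ) : (n + 1) + (m + k) = n + (m + (k + 1)) := by omega

/-- Inserting `x₀ = c` into a family point: the riders are unchanged. [folklore] -/
theorem riders_insertNth_i0f (c : ℝ) (y' : Fin (n + (m + (k + 1))) → ℝ) (i : Fin (m + (k + 1))) :
    (Fin.insertNth (i0f n m k) c (fun j => y' (finCongr (fam_arity_eq n m k) j)) :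
        Fin ((n + 1) + (m + (k + 1))) → ℝ) (Fin.natAdd (n + 1) i) = y' (Fin.natAdd n i) := by
  rw [i0f, Fin.insertNth_zero']
  have : (Fin.natAdd (n + 1) i : Fin ((n + 1) + (m + (k + 1)))) =
      Fin.succ (⟨n + i, by omega⟩ : Fin ((n + 1) + (m + k))) := by
    apply Fin.ext; simp; omega
  rw [this, Fin.cons_succ]
  simp only [finCongr_apply_mk]
  rfl

/-- Inserting `x₀ = c` into a family point and reading the family point is `x0cons`. [folklore] -/
theorem famPt_insertNth_i0f (π : MvPolynomial (Fin (m + (k + 1))) ℚ) (c : ℝ) (y' : Fin (n + (m + (k + 1))) → ℝ) :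
    famPt (n + 1) π (Fin.insertNth (i0f n m k) c (fun j => y' (finCongr (fam_arity_eq n m k) j)) :
        Fin ((n + 1) + (m + (k + 1))) → ℝ) = x0cons c (famPt n π y') := by
  set Y : Fin ((n + 1) + (m + (k + 1))) → ℝ :=
    Fin.insertNth (i0f n m k) c (fun j => y' (finCongr (fam_arity_eq n m k) j)) with hY
  have hY0 : Y (Fin.castAdd (m + (k + 1)) 0) = c := by
    have : (Fin.castAdd (m + (k + 1)) (0 : Fin (n + 1)) : Fin ((n + 1) + (m + (k + 1)))) = i0f n m k := Fin.ext rfl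
    rw [this, hY, Fin.insertNth_apply_same]
  have hYw : ∀ j : Fin n, Y (Fin.castAdd (m + (k + 1)) j.succ) = y' (Fin.castAdd (m + (k + 1)) j) := by
    intro j
    rw [hY, i0f, Fin.insertNth_zero']
    have : (Fin.castAdd (m + (k + 1)) j.succ : Fin ((n + 1) + (m + (k + 1)))) =
        Fin.succ (⟨j, by omega⟩ : Fin ((n + 1) + (m + k))) := by
      apply Fin.ext; simp
    rw [this, Fin.cons_succ]
    simp only [finCongr_apply_mk]
    rfl
  have hYr : ∀ i : Fin (m + (k + 1)), Y (Fin.natAdd (n + 1) i) = y' (Fin.natAdd n i) := fun i => by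
    rw [hY]; exact riders_insertNth_i0f c y' i
  rw [x0cons_eq_cons]
  funext i
  induction i using Fin.lastCases with
  | last =>
    simp only [famPt, Fin.snoc_last]
    have : (Fin.last (n + 1 + m) : Fin (((n + 1) + m) + 1)) = Fin.succ (⟨n + m, by omega⟩ : Fin ((n + 1) + m)) := by
      apply Fin.ext; simp; omega
    rw [this, Fin.cons_succ]
    simp only [finCongr_apply_mk]
    rw [show (⟨n + m, (by omega : n + m < n + m + 1)⟩ : Fin ((n + m) + 1)) = Fin.last (n + m) from Fin.ext rfl, Fin.snoc_last,
      show (fun i => Y (Fin.natAdd (n + 1) i)) = (fun i => y' (Fin.natAdd n i)) from funext hYr]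
  | cast i =>
    simp only [famPt, Fin.snoc_castSucc]
    induction i using Fin.addCases with
    | left j =>
      simp only [Fin.append_left]
      refine Fin.cases ?_ (fun j => ?_) j
      · rw [hY0]; rfl
      · rw [hYw]
        have : (Fin.castSucc (Fin.castAdd m j.succ) : Fin (((n + 1) + m) + 1)) =
            Fin.succ (⟨j, by omega⟩ : Fin ((n + 1) + m)) := by
          apply Fin.ext; simp
        rw [this, Fin.cons_succ]
        simp only [finCongr_apply_mk]
        rw [show (⟨(j : ℕ), (by omega : (j : ℕ) < n + m + 1)⟩ : Fin ((n + m) + 1)) = Fin.castSucc (Fin.castAdd m j) from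
          Fin.ext rfl, Fin.snoc_castSucc, Fin.append_left]
    | right j =>
      simp only [Fin.append_right]
      rw [hYr]
      have : (Fin.castSucc (Fin.natAdd (n + 1) j) : Fin (((n + 1) + m) + 1)) =
          Fin.succ (⟨n + j, by omega⟩ : Fin ((n + 1) + m)) := by
        apply Fin.ext; simp; omega
      rw [this, Fin.cons_succ]
      simp only [finCongr_apply_mk]
      rw [show (⟨n + (j : ℕ), (by omega : n + (j : ℕ) < n + m + 1)⟩ : Fin ((n + m) + 1)) = Fin.castSucc (Fin.natAdd n j) from
        Fin.ext rfl, Fin.snoc_castSucc, Fin.append_right]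

include hrel in
/-- **A face `x₀ = c` of a family is the family of the face.** [folklore] -/
theorem chi_faceAt_famTerm_x0 (ρ : RFun (m + (k + 1))) (T : RFun (((n + 1) + m) + 1)) (π : MvPolynomial (Fin (m + (k + 1))) ℚ)
    (hπ : IsScale π) (c : ℚ) (hc : 0 ≤ c ∧ c ≤ 1) :
    ((famTerm ρ T π hπ : RFun (((n + 1) + (m + k)) + 1)).faceAt (i0f n m k) c hc).chi χ =
      (famTerm ρ (faceX0 c hc T) π hπ).chi χ := by
  rw [← RFun.chi_rename hrel _ (finCongr (fam_arity_eq n m k))]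
  refine RFun.chi_congr hrel fun y' _ => ?_
  rw [RFun.fn_rename, RFun.fn_faceAt, fn_famTerm, fn_famTerm, fn_faceX0]
  have hr : (fun i => (Fin.insertNth (i0f n m k) (c : ℝ) (y' ∘ ⇑(finCongr (fam_arity_eq n m k))) :
      Fin ((n + 1) + (m + (k + 1))) → ℝ) (Fin.natAdd (n + 1) i)) = fun i => y' (Fin.natAdd n i) := by
    funext i; exact riders_insertNth_i0f c y' i
  rw [hr]
  congr 1
  exact congrArg T.fn (famPt_insertNth_i0f π c y')

include hrel in
/-- **The Stokes move along `x₀` in a family.** `⟪ρ · (∂_{x₀}(x₀T))[π]⟫ = ⟪ρ · T|_{x₀=1}[π]⟫`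
(the face at `x₀ = 0` of `x₀ T` vanishes). [cite: Ayoub2014, Def. 10] -/
theorem chi_famTerm_eulerX0 (ρ : RFun (m + (k + 1))) (T : RFun (((n + 1) + m) + 1)) (π : MvPolynomial (Fin (m + (k + 1))) ℚ)
    (hπ : IsScale π) :
    (famTerm ρ (eulerX0 T) π hπ).chi χ =
      (famTerm ρ (faceX0 1 ⟨zero_le_one, le_rfl⟩ ((RFun.poly (X (ix0 n m))).mul T)) π hπ).chi χ -
      (famTerm ρ (faceX0 0 ⟨le_rfl, zero_le_one⟩ ((RFun.poly (X (ix0 n m))).mul T)) π hπ).chi χ := by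
  set U : RFun (((n + 1) + m) + 1) := (RFun.poly (X (ix0 n m))).mul T with hU
  have h1 : (famTerm ρ (eulerX0 T) π hπ).chi χ = ((famTerm ρ U π hπ : RFun (((n + 1) + (m + k)) + 1)).pd (i0f n m k)).chi χ :=
    RFun.chi_congr hrel fun y hy => (fn_pd_famTerm_x0 ρ U π hπ hy).symm
  rw [h1, RFun.chi_stokesAt hrel (i0f n m k), chi_faceAt_famTerm_x0 hrel, chi_faceAt_famTerm_x0 hrel]

/-- The head factor as a function of (riders, scale) only. [folklore] -/
def headS (c : ℚ) (hc : 0 ≤ c) (ℓ : Letter m) (hℓ : ℓ.IsRegular c) : RFun (m + 1) :=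
  (headF (n := 0) c hc ℓ hℓ).rename (finCongr (by omega : (0 + m) + 1 = m + 1))

/-- The last factor as a function of (riders, scale) only. [folklore] -/
def lastS (c : ℚ) (hc : 0 ≤ c) (ℓ : Letter m) (hℓ : ℓ.IsRegular c) : RFun (m + 1) :=
  (lastF (n := 0) c hc ℓ hℓ).rename (finCongr (by omega : (0 + m) + 1 = m + 1))

/-- Reading a zero-word-coordinate layout point through the arity cast. [folklore] -/
theorem comp_finCongr_zero_layout (w : Fin (m + 1) → ℝ) :
    wRider (n := 0) (w ∘ finCongr (by omega : (0 + m) + 1 = m + 1)) = (fun j : Fin m => w (Fin.castSucc j)) ∧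
      wScale (n := 0) (w ∘ finCongr (by omega : (0 + m) + 1 = m + 1)) = w (Fin.last m) := by
  constructor
  · funext j; simp only [wRider, Function.comp_apply]; congr 1; apply Fin.ext; simp
  · simp only [wScale, Function.comp_apply]; congr 1; apply Fin.ext; simp

/-- Value of `headS`. [folklore] -/
theorem fn_headS (c : ℚ) (hc : 0 ≤ c) (ℓ : Letter m) (hℓ : ℓ.IsRegular c) (w : Fin (m + 1) → ℝ) :
    (headS c hc ℓ hℓ).fn w = ℓ.cR (Fin.init w) (c * w (Fin.last m)) := by
  rw [headS, RFun.fn_rename, fn_headF, (comp_finCongr_zero_layout w).1, (comp_finCongr_zero_layout w).2]; rfl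

/-- Value of `lastS`. [folklore] -/
theorem fn_lastS (c : ℚ) (hc : 0 ≤ c) (ℓ : Letter m) (hℓ : ℓ.IsRegular c) (w : Fin (m + 1) → ℝ) :
    (lastS c hc ℓ hℓ).fn w = ℓ.lastR (Fin.init w) (c * w (Fin.last m)) := by
  rw [lastS, RFun.fn_rename, fn_lastF, (comp_finCongr_zero_layout w).1, (comp_finCongr_zero_layout w).2]; rfl

/-- Reading a (riders, scale) function with the scale `π`: a function of the riders. [folklore] -/
def scaleFam (H : RFun (m + 1)) (π : MvPolynomial (Fin (m + k)) ℚ) (hπ : IsScale π) : RFun (m + k) :=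
  H.subst (Fin.lastCases π fun j => X (Fin.castAdd k j)) fun e he => by
    intro i
    induction i using Fin.lastCases with
    | last => simp only [Fin.lastCases_last]; exact hπ e he
    | cast j => simp only [Fin.lastCases_castSucc, aeval_X]; exact he _

/-- Value of `scaleFam`. [folklore] -/
theorem fn_scaleFam (H : RFun (m + 1)) (π : MvPolynomial (Fin (m + k)) ℚ) (hπ : IsScale π) (e : Fin (m + k) → ℝ) :
    (scaleFam H π hπ).fn e = H.fn (Fin.snoc (fun j => e (Fin.castAdd k j)) (aeval e π)) := by
  rw [scaleFam, RFun.fn_subst]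
  congr 1
  funext i
  induction i using Fin.lastCases with
  | last => simp
  | cast j => simp

/-- The head factor of a letter read with the scale `π`: a function of the riders. [folklore] -/
def headMult (c : ℚ) (hc : 0 ≤ c) (ℓ : Letter m) (hℓ : ℓ.IsRegular c) (π : MvPolynomial (Fin (m + k)) ℚ)
    (hπ : IsScale π) : RFun (m + k) :=
  scaleFam (headS c hc ℓ hℓ) π hπ

/-- The last factor of a letter read with the scale `π`. [folklore] -/
def lastMult (c : ℚ) (hc : 0 ≤ c) (ℓ : Letter m) (hℓ : ℓ.IsRegular c) (π : MvPolynomial (Fin (m + k)) ℚ)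
    (hπ : IsScale π) : RFun (m + k) :=
  scaleFam (lastS c hc ℓ hℓ) π hπ

/-- Moving a scale-only factor from the word function into the multiplier. [folklore] -/
theorem fn_famTerm_mul_scaleOnly (ρ : RFun (m + k)) (H : RFun (m + 1)) (Hn : RFun ((n + m) + 1))
    (hH : ∀ z, Hn.fn z = H.fn (Fin.snoc (wRider z) (wScale z)))
    (T : RFun ((n + m) + 1)) (π : MvPolynomial (Fin (m + k)) ℚ) (hπ : IsScale π) (y : Fin (n + (m + k)) → ℝ) :
    (famTerm ρ (Hn.mul T) π hπ).fn y = (famTerm (ρ.mul (scaleFam H π hπ)) T π hπ).fn y := by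
  rw [fn_famTerm, fn_famTerm, RFun.fn_mul, RFun.fn_mul, fn_scaleFam, hH]
  have : (Fin.snoc (wRider (famPt n π y)) (wScale (famPt n π y)) : Fin (m + 1) → ℝ) =
      Fin.snoc (fun j => y (Fin.natAdd n (Fin.castAdd k j))) (aeval (fun i => y (Fin.natAdd n i)) π) := by
    funext i
    induction i using Fin.lastCases with
    | last => rw [Fin.snoc_last, Fin.snoc_last, wScale_famPt]
    | cast j => rw [Fin.snoc_castSucc, Fin.snoc_castSucc, wRider_famPt]
  rw [this]; ring

/-- The head factor in `n` word coordinates is `headS` read on (riders, scale). [folklore] -/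
theorem fn_headF_eq (c : ℚ) (hc : 0 ≤ c) (ℓ : Letter m) (hℓ : ℓ.IsRegular c) (z : Fin ((n + m) + 1) → ℝ) :
    (headF (n := n) c hc ℓ hℓ).fn z = (headS c hc ℓ hℓ).fn (Fin.snoc (wRider z) (wScale z)) := by
  rw [fn_headF, fn_headS, Fin.init_snoc, Fin.snoc_last]

/-- The same for the last factor. [folklore] -/
theorem fn_lastF_eq (c : ℚ) (hc : 0 ≤ c) (ℓ : Letter m) (hℓ : ℓ.IsRegular c) (z : Fin ((n + m) + 1) → ℝ) :
    (lastF (n := n) c hc ℓ hℓ).fn z = (lastS c hc ℓ hℓ).fn (Fin.snoc (wRider z) (wScale z)) := by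
  rw [fn_lastF, fn_lastS, Fin.init_snoc, Fin.snoc_last]

include hrel in
/-- **The (O)-step for a peeling function.** If `T(z) = P(peelPt z)` on the cube then
`⟪ρ · (∂_τ(τ T))[π]⟫ = ⟪ρ · P[π]⟫` (Euler homogeneity, Stokes along `x₀`, faces). [folklore] -/
theorem chi_famTerm_scaleDeriv_of_peel (T : RFun (((n + 1) + m) + 1)) (P : RFun ((n + m) + 1))
    (hpeel : ∀ z ∈ KZ.cube (((n + 1) + m) + 1), T.fn z = P.fn (peelPt z))
    (ρ : RFun (m + (k + 1))) (π : MvPolynomial (Fin (m + (k + 1))) ℚ) (hπ : IsScale π) :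
    (famTerm ρ (scaleDeriv T) π hπ).chi χ = (famTerm ρ P π hπ).chi χ := by
  have h1 : (famTerm ρ (scaleDeriv T) π hπ).chi χ = (famTerm ρ (eulerX0 T) π hπ).chi χ :=
    RFun.chi_congr hrel fun y hy => by
      have key := fn_scaleDeriv_eq_eulerX0 _ _ hpeel (z := famPt (n + 1) π y) (famPt_mem hπ hy)
      rw [fn_famTerm, fn_famTerm, key]
  rw [h1, chi_famTerm_eulerX0 hrel]
  have h0 : (famTerm ρ (faceX0 0 ⟨le_rfl, zero_le_one⟩ ((RFun.poly (X (ix0 n m))).mul T)) π hπ).chi χ = 0 :=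
    RFun.chi_eq_zero hrel fun y hy => by
      rw [fn_famTerm, (fn_faceX0_mul_of_peel _ _ hpeel (famPt_mem hπ hy)).2, mul_zero]
  rw [h0, sub_zero]
  exact RFun.chi_congr hrel fun y hy => by
    rw [fn_famTerm, (fn_faceX0_mul_of_peel _ _ hpeel (famPt_mem hπ hy)).1, fn_famTerm]

include hrel in
/-- **The (O)-step for one word.** For `v = a :: v'` with `v'` non-empty:
`⟪ρ · (∂_τ(τ Z_{a v'}))[π]⟫ = ⟪(ρ · c_{d a}(c̄π)) · Z_{v'}[π]⟫`. [folklore] -/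
theorem chi_famTerm_scaleDeriv_cons {ι : Type} (c : ℚ) (hc : 0 ≤ c) (d : ι → Letter m) (hd : ∀ a, (d a).IsRegular c)
    (a : ι) (v : List ι) (hv0 : v ≠ []) (ρ : RFun (m + (k + 1))) (π : MvPolynomial (Fin (m + (k + 1))) ℚ)
    (hπ : IsScale π) :
    (famTerm ρ (scaleDeriv (Zw c hc d hd (a :: v))) π hπ).chi χ =
      (famTerm (ρ.mul (headMult c hc (d a) (hd a) π hπ)) (Zw c hc d hd v) π hπ).chi χ := by
  have hpeel : ∀ z ∈ KZ.cube (((v.length + 1) + m) + 1),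
      (Zw c hc d hd (a :: v)).fn z = (peelF c hc d hd a v).fn (peelPt z) := fun z hz => fn_Zw_eq_peelF c hc d hd a v z hz
  have h1 : (famTerm ρ (scaleDeriv (Zw c hc d hd (a :: v))) π hπ).chi χ =
      (famTerm ρ (eulerX0 (Zw c hc d hd (a :: v))) π hπ).chi χ :=
    RFun.chi_congr hrel fun y hy => by
      have key := fn_scaleDeriv_eq_eulerX0 _ _ hpeel (z := famPt (a :: v).length π y) (famPt_mem hπ hy)
      rw [fn_famTerm, fn_famTerm, key]
      simp only [List.length_cons]
  rw [h1, chi_famTerm_eulerX0 hrel]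
  have h0 : (famTerm ρ (faceX0 0 ⟨le_rfl, zero_le_one⟩ ((RFun.poly (X (ix0 v.length m))).mul (Zw c hc d hd (a :: v)))) π hπ).chi χ = 0 :=
    RFun.chi_eq_zero hrel fun y hy => by
      rw [fn_famTerm, (fn_faceX0_mul_of_peel _ _ hpeel (famPt_mem hπ hy)).2, mul_zero]
  rw [h0, sub_zero]
  refine RFun.chi_congr hrel fun y hy => ?_
  rw [fn_famTerm, (fn_faceX0_mul_of_peel _ _ hpeel (famPt_mem hπ hy)).1, peelF, if_neg hv0, ← fn_famTerm,
    fn_famTerm_mul_scaleOnly ρ (headS c hc (d a) (hd a)) _ (fn_headF_eq c hc (d a) (hd a))]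
  rfl

include hrel in
/-- **The (O)-step for a one-letter word.** `⟪ρ · (∂_τ(τ Z_{[a]}))[π]⟫ = ⟪ρ · last_{d a}(c̄π)⟫`.
[folklore] -/
theorem chi_famTerm_scaleDeriv_singleton {ι : Type} (c : ℚ) (hc : 0 ≤ c) (d : ι → Letter m)
    (hd : ∀ a, (d a).IsRegular c) (a : ι) (ρ : RFun (m + (k + 1))) (π : MvPolynomial (Fin (m + (k + 1))) ℚ)
    (hπ : IsScale π) :
    (famTerm ρ (scaleDeriv (Zw c hc d hd [a])) π hπ).chi χ = (ρ.mul (lastMult c hc (d a) (hd a) π hπ)).chi χ := by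
  have hpeel : ∀ z ∈ KZ.cube (((0 + 1) + m) + 1),
      (Zw c hc d hd [a]).fn z = (peelF c hc d hd a []).fn (peelPt z) := fun z hz => fn_Zw_eq_peelF c hc d hd a [] z hz
  have h1 : (famTerm ρ (scaleDeriv (Zw c hc d hd [a])) π hπ).chi χ =
      (famTerm ρ (eulerX0 (Zw c hc d hd [a])) π hπ).chi χ :=
    RFun.chi_congr hrel fun y hy => by
      have key := fn_scaleDeriv_eq_eulerX0 _ _ hpeel (z := famPt [a].length π y) (famPt_mem hπ hy)
      rw [fn_famTerm, fn_famTerm, key]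
      simp only [List.length_cons, List.length_nil]
  rw [h1, chi_famTerm_eulerX0 hrel]
  simp only [List.length_nil]
  have h0 : (famTerm ρ (faceX0 0 ⟨le_rfl, zero_le_one⟩ ((RFun.poly (X (ix0 0 m))).mul (Zw c hc d hd [a]))) π hπ).chi χ = 0 :=
    RFun.chi_eq_zero hrel fun y hy => by
      rw [fn_famTerm, (fn_faceX0_mul_of_peel _ _ hpeel (famPt_mem hπ hy)).2, mul_zero]
  rw [h0, sub_zero]
  -- `famTerm ρ (lastF) π` on zero word coordinates is `ρ · lastMult`
  have h2 : (famTerm ρ (faceX0 1 ⟨zero_le_one, le_rfl⟩ ((RFun.poly (X (ix0 0 m))).mul (Zw c hc d hd [a]))) π hπ).chi χ =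
      (famTerm (n := 0) (ρ.mul (lastMult c hc (d a) (hd a) π hπ)) (RFun.const 1) π hπ).chi χ := by
    refine RFun.chi_congr hrel fun y hy => ?_
    rw [fn_famTerm, (fn_faceX0_mul_of_peel _ _ hpeel (famPt_mem hπ hy)).1, peelF, if_pos rfl]
    have hval : (lastF c hc (d a) (hd a) : RFun ((0 + m) + 1)).fn (famPt 0 π y) =
        ((lastF c hc (d a) (hd a)).mul (RFun.const 1)).fn (famPt 0 π y) := by
      rw [RFun.fn_mul, RFun.fn_const]; push_cast; ring
    rw [hval, ← fn_famTerm, fn_famTerm_mul_scaleOnly ρ (lastS c hc (d a) (hd a)) _ (fn_lastF_eq c hc (d a) (hd a))]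
    rfl
  rw [h2]
  -- drop the constant word function and the `pre 0`
  have h3 : ∀ y ∈ KZ.cube (0 + (m + (k + 1))),
      (famTerm (n := 0) (ρ.mul (lastMult c hc (d a) (hd a) π hπ)) (RFun.const 1) π hπ).fn y =
        ((ρ.mul (lastMult c hc (d a) (hd a) π hπ)).pre 0).fn y := fun y _ => by
    rw [fn_famTerm, RFun.fn_const, RFun.fn_pre]; push_cast; ring
  rw [RFun.chi_congr hrel h3, RFun.pre_eq_rename_liftN, RFun.chi_rename hrel, RFun.chi_liftN hrel]

end FamilyX0

/-! ## Level 2: regularised series of a chart direction and the identities (S), (O) -/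

section Series

open Shuffle

variable {R : Type} [CommRing R] [Algebra ℚ R] {χ : KZ.FormalRep →+ R} (hrel : ∀ c ∈ KZ.relations, χ c = 0)

variable {ι : Type} [Fintype ι] [DecidableEq ι] {m k : ℕ}

/-! ### Finsupp bookkeeping: first-letter restriction -/

/-- The first-letter restriction `(tailAt ℓ F)(v) = F(ℓ v)`. [folklore] -/
def tailAt (ℓ : ι) (F : List ι →₀ ℚ) : List ι →₀ ℚ :=
  Finsupp.comapDomain (List.cons ℓ) F List.cons_injective.injOn

omit [Fintype ι] [DecidableEq ι] in
/-- Value of the first-letter restriction. [folklore] -/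
@[simp] theorem tailAt_apply (ℓ : ι) (F : List ι →₀ ℚ) (v : List ι) : tailAt ℓ F v = F (ℓ :: v) :=
  Finsupp.comapDomain_apply _ _ _ _

omit [Fintype ι] [DecidableEq ι] in
/-- `tailAt` is additive. [folklore] -/
theorem tailAt_add (ℓ : ι) (F G : List ι →₀ ℚ) : tailAt ℓ (F + G) = tailAt ℓ F + tailAt ℓ G := by
  ext v; simp

omit [Fintype ι] [DecidableEq ι] in
/-- `tailAt` of zero. [folklore] -/
@[simp] theorem tailAt_zero (ℓ : ι) : tailAt ℓ (0 : List ι →₀ ℚ) = 0 := by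
  ext v; simp

omit [Fintype ι] in
/-- `tailAt` of a single word. [folklore] -/
theorem tailAt_single_cons (ℓ a : ι) (v : List ι) (b : ℚ) :
    tailAt ℓ (Finsupp.single (a :: v) b) = if ℓ = a then Finsupp.single v b else 0 := by
  ext w
  rw [tailAt_apply]
  by_cases h : ℓ = a
  · subst h; rw [if_pos rfl]
    by_cases hw : w = v
    · subst hw; simp
    · rw [Finsupp.single_eq_of_ne (by simpa using hw), Finsupp.single_eq_of_ne hw]
  · rw [if_neg h, Finsupp.single_eq_of_ne (by simp [h]), Finsupp.zero_apply]

omit [Fintype ι] [DecidableEq ι] in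
/-- The pairing is additive in the series. [folklore] -/
theorem pair_add_fun' {K : Type*} [AddCommMonoid K] [Module ℚ K] (g g' : List ι → K) (F : List ι →₀ ℚ) :
    pair (fun v => g v + g' v) F = pair g F + pair g' F := by
  unfold pair
  rw [← Finsupp.sum_add]
  exact Finsupp.sum_congr fun v _ => smul_add _ _ _

omit [Fintype ι] [DecidableEq ι] in
/-- The pairing of the zero series. [folklore] -/
theorem pair_zero' {K : Type*} [AddCommMonoid K] [Module ℚ K] (F : List ι →₀ ℚ) :
    pair (fun _ : List ι => (0 : K)) F = 0 := by
  simp [pair]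

omit [Fintype ι] [DecidableEq ι] in
/-- `⟨g, F − G⟩ = ⟨g, F⟩ − ⟨g, G⟩`. [folklore] -/
theorem pair_sub' {K : Type*} [AddCommGroup K] [Module ℚ K] (g : List ι → K) (F G : List ι →₀ ℚ) :
    pair g (F - G) = pair g F - pair g G := by
  rw [sub_eq_add_neg, show -G = (-1 : ℚ) • G by simp, Shuffle.pair_add, pair_smul]
  simp [sub_eq_add_neg]

/-- **Grouping a pairing by the first letter.** For `F` with no mass on the empty word,
`⟨g, F⟩ = Σ_ℓ ⟨g(ℓ ·), tailAt ℓ F⟩`. [folklore] -/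
theorem pair_eq_sum_tailAt {K : Type*} [AddCommGroup K] [Module ℚ K] (g : List ι → K) (F : List ι →₀ ℚ)
    (hF : F [] = 0) : pair g F = ∑ ℓ, pair (fun v => g (ℓ :: v)) (tailAt ℓ F) := by
  induction F using Finsupp.induction with
  | zero => simp [pair_zero]
  | single_add v b f hv hb ih =>
    have hvne : v ≠ [] := by
      rintro rfl
      have hf0 : f [] = 0 := Finsupp.notMem_support_iff.1 hv
      rw [Finsupp.add_apply, Finsupp.single_eq_same, hf0, add_zero] at hF
      exact hb hF
    have hf : f [] = 0 := by
      rw [Finsupp.add_apply, Finsupp.single_eq_of_ne (Ne.symm hvne), zero_add] at hF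
      exact hF
    obtain ⟨a, v', rfl⟩ := List.exists_cons_of_ne_nil hvne
    rw [Shuffle.pair_add, pair_single, ih hf]
    simp only [tailAt_add, Shuffle.pair_add, Finset.sum_add_distrib, tailAt_single_cons]
    congr 1
    rw [Finset.sum_eq_single a (fun ℓ _ hne => by rw [if_neg hne, pair_zero]) (fun h => (h (Finset.mem_univ a)).elim),
      if_pos rfl, pair_single]

omit [Fintype ι] in
/-- Words in the support of `regEnd x w` have the length of `w`. [folklore] -/
theorem length_of_mem_support_regEnd (x : ι) (w : List ι) {u : List ι} (hu : u ∈ (regEnd x w).support) :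
    u.length = w.length := by
  rw [regEnd, Finsupp.mapDomain_support_of_injective List.reverse_injective, Finset.mem_image] at hu
  obtain ⟨v, hv, rfl⟩ := hu
  obtain ⟨i, hi, hmem⟩ := exists_of_mem_support_regFront x _ hv
  have h := MZV.length_of_mem_shuffleWord _ _ hmem
  rw [List.length_replicate, List.length_drop, List.length_reverse] at h
  have hle : i ≤ w.length := by
    have := hi.trans (by unfold leadCount; exact (List.takeWhile_prefix _).length_le : leadCount x w.reverse ≤ w.reverse.length)
    simpa using this
  rw [List.length_reverse, h]; omega

omit [Fintype ι] in
/-- `regEnd x [] = []`. [folklore] -/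
theorem regEnd_nil' (x : ι) : regEnd x ([] : List ι) = Finsupp.single [] 1 := by
  simp [regEnd, regFront, leadCount, shuffleSum, wordSum]

omit [Fintype ι] in
/-- The first-letter restriction of `regEnd` (the landed stub `regEnd_apply_cons`). [cite:
IharaKanekoZagier2006, Cor. 5] -/
theorem tailAt_regEnd (o ℓ : ι) (W : List ι) :
    tailAt ℓ (regEnd o W) = (if W.head? = some ℓ then regEnd o W.tail else 0) -
      (if ℓ = o ∧ W.getLast? = some o then regEnd o W.dropLast else 0) := by
  ext v
  rw [tailAt_apply, Shuffle.regEnd_apply_cons ι o ℓ W v,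
    Finsupp.sub_apply]
  congr 1 <;> split_ifs <;> rfl

/-! ### The coefficient families and the series -/

variable (c : ℚ) (hc : 0 ≤ c) (d : ι → Letter m) (hd : ∀ a, (d a).IsRegular c)

/-- The `Z`-coefficient of a word: `⟪ρ · Z_v[π]⟫`. [folklore] -/
def zcoef (ρ : RFun (m + k)) (π : MvPolynomial (Fin (m + k)) ℚ) (hπ : IsScale π) (v : List ι) : R :=
  (famTerm ρ (Zw c hc d hd v) π hπ).chi χ

/-- The `D`-coefficient of a word: `⟪ρ · (∂_τ(τ Z_v))[π]⟫`. [folklore] -/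
def dcoef (ρ : RFun (m + k)) (π : MvPolynomial (Fin (m + k)) ℚ) (hπ : IsScale π) (v : List ι) : R :=
  (famTerm ρ (scaleDeriv (Zw c hc d hd v)) π hπ).chi χ

/-- **The regularised `Z`-series** `𝐙(ρ,π)(W) = ⟨zcoef, regEnd o W⟩` (`0` on the empty word).
[cite: IharaKanekoZagier2006, §3] -/
def Zser (o : ι) (ρ : RFun (m + k)) (π : MvPolynomial (Fin (m + k)) ℚ) (hπ : IsScale π) : NCSeries ι R :=
  fun W => if W = [] then 0 else pair (zcoef (χ := χ) c hc d hd ρ π hπ) (regEnd o W)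

/-- **The regularised `D`-series** `𝐃(ρ,π)(W) = ⟨dcoef, regEnd o W⟩` (`0` on the empty word).
[cite: IharaKanekoZagier2006, §3] -/
def Dser (o : ι) (ρ : RFun (m + k)) (π : MvPolynomial (Fin (m + k)) ℚ) (hπ : IsScale π) : NCSeries ι R :=
  fun W => if W = [] then 0 else pair (dcoef (χ := χ) c hc d hd ρ π hπ) (regEnd o W)

include hrel

omit [Fintype ι] in
/-- **(S)**: `𝐙(ρ, π) = 𝐃(ρ⁺, π·v)` — the rider Stokes move, word by word. [folklore] -/
theorem Zser_eq_Dser (o : ι) (ρ : RFun (m + k)) (π : MvPolynomial (Fin (m + k)) ℚ) (hπ : IsScale π) (W : List ι) :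
    Zser (χ := χ) c hc d hd o ρ π hπ W =
      Dser (χ := χ) c hc d hd o (k := k + 1) ρ.lift (scaleMul π) (isScale_scaleMul hπ) W := by
  simp only [Zser, Dser]
  split_ifs
  · rfl
  · exact pair_congr fun v _ => chi_famTerm_eq_scaleDeriv hrel ρ _ π hπ

omit [Algebra ℚ R] [Fintype ι] [DecidableEq ι] in
/-- A head factor of the invisible letter does not change the multiplier. [folklore] -/
theorem zcoef_mul_headMult_inv (ρ : RFun (m + (k + 1))) (π : MvPolynomial (Fin (m + (k + 1))) ℚ) (hπ : IsScale π)
    {o : ι} (hdo : d o = Letter.inv) (v : List ι) :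
    zcoef (χ := χ) c hc d hd (ρ.mul (headMult c hc (d o) (hd o) π hπ)) π hπ v = zcoef (χ := χ) c hc d hd ρ π hπ v := by
  refine RFun.chi_congr hrel fun y _ => ?_
  rw [fn_famTerm, fn_famTerm, RFun.fn_mul, headMult, fn_scaleFam, fn_headS]
  generalize hd o = h
  revert h
  rw [hdo]
  intro h
  rw [Letter.cR_inv, mul_one]

omit [Algebra ℚ R] [Fintype ι] [DecidableEq ι] in
/-- A last factor of the invisible letter is `1`. [folklore] -/
theorem chi_mul_lastMult_inv (ρ : RFun (m + (k + 1))) (π : MvPolynomial (Fin (m + (k + 1))) ℚ) (hπ : IsScale π)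
    {o : ι} (hdo : d o = Letter.inv) :
    (ρ.mul (lastMult c hc (d o) (hd o) π hπ)).chi χ = ρ.chi χ := by
  refine RFun.chi_congr hrel fun y _ => ?_
  rw [RFun.fn_mul, lastMult, fn_scaleFam, fn_lastS]
  generalize hd o = h
  revert h
  rw [hdo]
  intro h
  rw [Letter.lastR_inv, mul_one]

omit [Fintype ι] in
/-- Pairing the `D`-coefficients of `ℓ`-prefixed words against `regEnd o U`. [folklore] -/
theorem pair_dcoef_cons (o ℓ : ι) (ρ : RFun (m + (k + 1))) (π : MvPolynomial (Fin (m + (k + 1))) ℚ) (hπ : IsScale π)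
    (U : List ι) :
    pair (fun v => dcoef (χ := χ) c hc d hd ρ π hπ (ℓ :: v)) (regEnd o U) =
      if U = [] then (ρ.mul (lastMult c hc (d ℓ) (hd ℓ) π hπ)).chi χ
      else Zser (χ := χ) c hc d hd o (ρ.mul (headMult c hc (d ℓ) (hd ℓ) π hπ)) π hπ U := by
  by_cases hU : U = []
  · subst hU
    rw [if_pos rfl, regEnd_nil', pair_single, one_smul]
    exact chi_famTerm_scaleDeriv_singleton hrel c hc d hd ℓ ρ π hπ
  · rw [if_neg hU, Zser, if_neg hU]
    refine pair_congr fun v hv => ?_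
    have hvne : v ≠ [] := by
      intro h
      have := length_of_mem_support_regEnd o U hv
      rw [h, List.length_nil] at this
      exact hU (List.length_eq_zero_iff.1 this.symm)
    exact chi_famTerm_scaleDeriv_cons hrel c hc d hd ℓ v hvne ρ π hπ

/-- **(O)**: the gauged transport equation of the regularised series, coefficient by coefficient:
for `W = ℓ₀ W₀`,
`𝐃(ρ,π)(W) = [W₀ = []]⟪ρ·last_{ℓ₀}⟫ + [W₀ ≠ []] 𝐙(ρ·c_{ℓ₀}, π)(W₀) − [W ends in o] 𝐙(ρ,π)(W minus its last letter)`
(with `⟪ρ⟫` in place of `𝐙(ρ,π)([])`) — the cube form of `∂_β Q = Ω_y Q − Q t_o/β`.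
[cite: IharaKanekoZagier2006, §3] -/
theorem Dser_cons (o : ι) (hdo : d o = Letter.inv) (ρ : RFun (m + (k + 1))) (π : MvPolynomial (Fin (m + (k + 1))) ℚ)
    (hπ : IsScale π) (ℓ₀ : ι) (W₀ : List ι) :
    Dser (χ := χ) c hc d hd o ρ π hπ (ℓ₀ :: W₀) =
      (if W₀ = [] then (ρ.mul (lastMult c hc (d ℓ₀) (hd ℓ₀) π hπ)).chi χ
        else Zser (χ := χ) c hc d hd o (ρ.mul (headMult c hc (d ℓ₀) (hd ℓ₀) π hπ)) π hπ W₀) -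
      (if (ℓ₀ :: W₀).getLast? = some o then
        (if (ℓ₀ :: W₀).dropLast = [] then ρ.chi χ else Zser (χ := χ) c hc d hd o ρ π hπ (ℓ₀ :: W₀).dropLast)
        else 0) := by
  have hW : (ℓ₀ :: W₀) ≠ [] := List.cons_ne_nil _ _
  have h0 : (regEnd o (ℓ₀ :: W₀)) [] = 0 := by
    by_contra h
    have := length_of_mem_support_regEnd o (ℓ₀ :: W₀) (Finsupp.mem_support_iff.2 h)
    simp at this
  rw [Dser, if_neg hW, pair_eq_sum_tailAt _ _ h0]
  simp only [tailAt_regEnd, pair_sub', Finset.sum_sub_distrib]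
  congr 1
  · -- the head term: only `ℓ = ℓ₀` contributes
    rw [Finset.sum_eq_single ℓ₀ (fun ℓ _ hne => by rw [if_neg (by simpa using Ne.symm hne), pair_zero])
      (fun h => (h (Finset.mem_univ _)).elim), if_pos (by simp), List.tail_cons]
    exact pair_dcoef_cons hrel c hc d hd o ℓ₀ ρ π hπ W₀
  · -- the gauge term: only `ℓ = o` contributes
    rw [Finset.sum_eq_single o (fun ℓ _ hne => by rw [if_neg (fun h => hne h.1), pair_zero])
      (fun h => (h (Finset.mem_univ _)).elim)]
    by_cases hlast : (ℓ₀ :: W₀).getLast? = some o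
    · rw [if_pos ⟨rfl, hlast⟩, if_pos hlast, pair_dcoef_cons hrel c hc d hd o o ρ π hπ]
      split_ifs with hnil
      · exact chi_mul_lastMult_inv hrel c hc d hd ρ π hπ hdo
      · simp only [Zser, if_neg hnil]
        exact pair_congr fun v _ => zcoef_mul_headMult_inv hrel c hc d hd ρ π hπ hdo v
    · rw [if_neg (fun h => hlast h.2), if_neg hlast, pair_zero]

end Series

/-! ## The transverse FTC move, and substituting the transverse rider -/

section Transverse

variable {R : Type} [CommRing R] {χ : KZ.FormalRep →+ R} (hrel : ∀ c ∈ KZ.relations, χ c = 0)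
variable {m n k : ℕ}

omit hrel in
/-- The zero scale. [folklore] -/
theorem isScale_zero : IsScale (0 : MvPolynomial (Fin (m + k)) ℚ) := fun _ _ => by simp

omit hrel in
/-- The initial segment of a family point does not depend on the scale. [folklore] -/
theorem init_famPt (π π' : MvPolynomial (Fin (m + k)) ℚ) (y : Fin (n + (m + k)) → ℝ) :
    Fin.init (famPt n π y) = Fin.init (famPt n π' y) := by
  funext i; simp [famPt, Fin.init]

include hrel in
/-- **The transverse FTC move**: `⟪ρ · T[Υ]⟫ − ⟪ρ · T[0]⟫ = ⟪(ρΥ)⁺ · (∂_τ T)[Υ·s]⟫ with a new rider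
`s ∈ [0,1]` (Stokes along `s` for `F = ρ · T[τ := Υ s]`). [cite: KontsevichZagier2001, §1.2 rule (3)] -/
theorem chi_famTerm_sub_zero (ρ : RFun (m + k)) (T : RFun ((n + m) + 1)) (Υ : MvPolynomial (Fin (m + k)) ℚ)
    (hΥ : IsScale Υ) :
    (famTerm ρ T Υ hΥ).chi χ - (famTerm ρ T 0 isScale_zero).chi χ =
      (famTerm (k := k + 1) (ρ.mul (RFun.poly Υ)).lift T.dlast (scaleMul Υ) (isScale_scaleMul hΥ)).chi χ := by
  have hΥ' := isScale_scaleMul hΥ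
  set F : RFun ((n + (m + k)) + 1) := ((ρ.pre n).lift).mul (fam T (scaleMul Υ) hΥ') with hF
  have hst := RFun.chi_stokesAt hrel (Fin.last _) F
  have hFval : ∀ (y : Fin (n + (m + k)) → ℝ) (v : ℝ), F.fn (Fin.snoc y v) =
      ρ.fn (fun i => y (Fin.natAdd n i)) * T.fn (Fin.snoc (Fin.init (famPt n Υ y))
        (aeval (fun i => y (Fin.natAdd n i)) Υ * v)) := by
    intro y v
    rw [hF, RFun.fn_mul, RFun.fn_lift_snoc, RFun.fn_pre, fn_fam, famPt_scaleMul_snoc]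
  have e1 : (F.faceAt (Fin.last _) 1 ⟨zero_le_one, le_rfl⟩).chi χ = (famTerm ρ T Υ hΥ).chi χ := by
    refine RFun.chi_congr hrel fun y _ => ?_
    rw [RFun.fn_faceAt, Fin.insertNth_last', fn_famTerm]
    push_cast
    rw [hFval, mul_one, ← wScale_famPt Υ y, wScale, Fin.snoc_init_self]
  have e0 : (F.faceAt (Fin.last _) 0 ⟨le_rfl, zero_le_one⟩).chi χ = (famTerm ρ T 0 isScale_zero).chi χ := by
    refine RFun.chi_congr hrel fun y _ => ?_
    rw [RFun.fn_faceAt, Fin.insertNth_last', fn_famTerm]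
    push_cast
    rw [hFval, mul_zero, init_famPt Υ 0 y]
    have : (0 : ℝ) = wScale (famPt n (0 : MvPolynomial (Fin (m + k)) ℚ) y) := by rw [wScale_famPt]; simp
    rw [this, wScale, Fin.snoc_init_self]
  have ed : (F.pd (Fin.last _)).chi χ =
      (famTerm (k := k + 1) (ρ.mul (RFun.poly Υ)).lift T.dlast (scaleMul Υ) hΥ').chi χ := by
    refine RFun.chi_congr hrel fun w hw => ?_
    have hw' : w = Fin.snoc (Fin.init w) (w (Fin.last _)) := (Fin.snoc_init_self w).symm
    set y : Fin (n + (m + k)) → ℝ := Fin.init w with hy_def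
    set v : ℝ := w (Fin.last _) with hv_def
    have hy : y ∈ KZ.cube (n + (m + k)) := fun i => hw (Fin.castSucc i)
    have hv : v ∈ Icc (0 : ℝ) 1 := ⟨(hw _).1, (hw _).2⟩
    rw [hw']
    set r : Fin (m + k) → ℝ := fun i => y (Fin.natAdd n i) with hr
    set p : Fin (n + m) → ℝ := Fin.init (famPt n Υ y) with hp_def
    set a : ℝ := aeval r Υ with ha_def
    have hr_mem : r ∈ KZ.cube (m + k) := rider_mem_cube hy
    have hp : p ∈ KZ.cube (n + m) := fun i => famPt_mem hΥ hy (Fin.castSucc i)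
    have ha : 0 ≤ a ∧ a ≤ 1 := hΥ r hr_mem
    have hav : a * v ∈ Icc (0 : ℝ) 1 := ⟨mul_nonneg ha.1 hv.1, mul_le_one₀ ha.2 hv.1 hv.2⟩
    have hL : HasDerivAt (fun s : ℝ => F.fn (Fin.snoc y s)) ((F.pd (Fin.last _)).fn (Fin.snoc y v)) v := by
      rw [RFun.pd_last]; exact F.hasDerivAt_fn_snoc hy hv
    have hfunF : (fun s : ℝ => F.fn (Fin.snoc y s)) = fun s => ρ.fn r * T.fn (Fin.snoc p (a * s)) := by
      funext s; rw [hFval]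
    rw [hfunF] at hL
    have hT : HasDerivAt (fun t : ℝ => T.fn (Fin.snoc p t)) (T.dlast.fn (Fin.snoc p (a * v))) (a * v) :=
      T.hasDerivAt_fn_snoc hp hav
    have hcomp : HasDerivAt (fun s : ℝ => T.fn (Fin.snoc p (a * s))) (T.dlast.fn (Fin.snoc p (a * v)) * a) v := by
      have ha' : HasDerivAt (fun s : ℝ => a * s) a v := by simpa using (hasDerivAt_id v).const_mul a
      exact hT.comp v ha'
    have hR : HasDerivAt (fun s : ℝ => ρ.fn r * T.fn (Fin.snoc p (a * s)))
        (ρ.fn r * (T.dlast.fn (Fin.snoc p (a * v)) * a)) v := hcomp.const_mul (ρ.fn r)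
    rw [hL.unique hR, fn_famTerm, RFun.fn_lift]
    have hinit : (Fin.init fun i : Fin (m + (k + 1)) => (Fin.snoc y v : Fin (n + (m + k) + 1) → ℝ) (Fin.natAdd n i)) = r := by
      funext j
      show (Fin.snoc y v : Fin (n + (m + k) + 1) → ℝ) (Fin.castSucc (Fin.natAdd n j)) = _
      rw [Fin.snoc_castSucc]
    rw [hinit, famPt_scaleMul_snoc, RFun.fn_mul, RFun.fn_poly]
    ring
  rw [← e1, ← e0, ← ed, hst]

/-! ### Substituting the transverse rider `υ` (the last letter rider) by a rider polynomial -/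

/-- The substitution `υ := Υ(e')` on the letter riders `(e, υ) ∈ [0,1]^{m+1}`. [folklore] -/
def riderSubstY (Υ : MvPolynomial (Fin (m + k)) ℚ) : Fin (m + 1) → MvPolynomial (Fin (m + k)) ℚ :=
  Fin.lastCases Υ fun j => X (Fin.castAdd k j)

omit hrel in
/-- Evaluating the rider substitution. [folklore] -/
theorem aeval_riderSubstY (Υ : MvPolynomial (Fin (m + k)) ℚ) (e : Fin (m + k) → ℝ) :
    (fun i => aeval e (riderSubstY Υ i)) = Fin.snoc (fun j => e (Fin.castAdd k j)) (aeval e Υ) := by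
  funext i
  induction i using Fin.lastCases with
  | last => simp [riderSubstY]
  | cast j => simp [riderSubstY]

omit hrel in
/-- The substituted rider point lies in the cube. [folklore] -/
theorem riderSubstY_mem {Υ : MvPolynomial (Fin (m + k)) ℚ} (hΥ : IsScale Υ) {e : Fin (m + k) → ℝ}
    (he : e ∈ KZ.cube (m + k)) : (fun i => (aeval e (riderSubstY Υ i) : ℝ)) ∈ KZ.cube (m + 1) := by
  rw [aeval_riderSubstY]
  intro i
  induction i using Fin.lastCases with
  | last => rw [Fin.snoc_last]; exact hΥ e he
  | cast j => rw [Fin.snoc_castSucc]; exact he _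

/-- Substituting `υ := Υ` in a letter. [folklore] -/
def Letter.substY (Υ : MvPolynomial (Fin (m + k)) ℚ) : Letter (m + 1) → Letter (m + k)
  | Letter.inv => Letter.inv
  | Letter.reg N M => Letter.reg (bind₁ (riderSubstY Υ) N) (bind₁ (riderSubstY Υ) M)

omit hrel in
/-- Regularity is preserved by the substitution. [folklore] -/
theorem Letter.isRegular_substY {c : ℚ} {Υ : MvPolynomial (Fin (m + k)) ℚ} (hΥ : IsScale Υ) (ℓ : Letter (m + 1))
    (hℓ : ℓ.IsRegular c) : (ℓ.substY Υ).IsRegular c := by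
  cases ℓ with
  | inv => trivial
  | reg N M =>
    intro s hs t ht0 ht1
    simp only [aeval_bind₁]
    exact hℓ _ (riderSubstY_mem hΥ hs) t ht0 ht1

/-- The word-layout substitution `υ := Υ(e')` (words and slot unchanged). [folklore] -/
def laySubstY (n : ℕ) (Υ : MvPolynomial (Fin (m + k)) ℚ) : Fin ((n + (m + 1)) + 1) → MvPolynomial (Fin ((n + (m + k)) + 1)) ℚ :=
  Fin.lastCases (X (Fin.last _))
    (Fin.addCases (fun j : Fin n => X (Fin.castSucc (Fin.castAdd (m + k) j)))
      (fun i : Fin (m + 1) => MvPolynomial.rename (Fin.castSucc ∘ Fin.natAdd n) (riderSubstY Υ i)))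

/-- The point read by the layout substitution. [folklore] -/
def yPt (n : ℕ) (Υ : MvPolynomial (Fin (m + k)) ℚ) (z : Fin ((n + (m + k)) + 1) → ℝ) : Fin ((n + (m + 1)) + 1) → ℝ :=
  Fin.snoc (Fin.append (wX z) (Fin.snoc (fun j => wRider z (Fin.castAdd k j)) (aeval (wRider z) Υ))) (wScale z)

omit hrel in
/-- Evaluating the layout substitution. [folklore] -/
theorem aeval_laySubstY (Υ : MvPolynomial (Fin (m + k)) ℚ) (z : Fin ((n + (m + k)) + 1) → ℝ) :
    (fun i => aeval z (laySubstY n Υ i)) = yPt n Υ z := by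
  funext i
  induction i using Fin.lastCases with
  | last => simp [laySubstY, yPt, wScale]
  | cast i =>
    simp only [laySubstY, yPt, Fin.lastCases_castSucc, Fin.snoc_castSucc]
    induction i using Fin.addCases with
    | left j => simp [wX]
    | right i =>
      simp only [Fin.addCases_right, Fin.append_right, aeval_rename]
      exact congrFun (aeval_riderSubstY Υ (wRider z)) i

omit hrel in
/-- Word coordinates of `yPt`. [folklore] -/
@[simp] theorem wX_yPt (Υ : MvPolynomial (Fin (m + k)) ℚ) (z : Fin ((n + (m + k)) + 1) → ℝ) : wX (yPt n Υ z) = wX z := by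
  funext j; simp [wX, yPt]

omit hrel in
/-- Riders of `yPt`. [folklore] -/
theorem wRider_yPt (Υ : MvPolynomial (Fin (m + k)) ℚ) (z : Fin ((n + (m + k)) + 1) → ℝ) :
    wRider (yPt n Υ z) = Fin.snoc (fun j => wRider z (Fin.castAdd k j)) (aeval (wRider z) Υ) := by
  funext j
  show yPt n Υ z (Fin.castSucc (Fin.natAdd n j)) = _
  rw [yPt, Fin.snoc_castSucc, Fin.append_right]

omit hrel in
/-- Scale of `yPt`. [folklore] -/
@[simp] theorem wScale_yPt (Υ : MvPolynomial (Fin (m + k)) ℚ) (z : Fin ((n + (m + k)) + 1) → ℝ) :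
    wScale (yPt n Υ z) = wScale z := by
  simp [wScale, yPt]

omit hrel in
/-- `yPt` maps the cube to the cube. [folklore] -/
theorem yPt_mem {Υ : MvPolynomial (Fin (m + k)) ℚ} (hΥ : IsScale Υ) {z : Fin ((n + (m + k)) + 1) → ℝ}
    (hz : z ∈ KZ.cube ((n + (m + k)) + 1)) : yPt n Υ z ∈ KZ.cube ((n + (m + 1)) + 1) := by
  intro i
  induction i using Fin.lastCases with
  | last => simp only [yPt, Fin.snoc_last]; exact hz _
  | cast i =>
    simp only [yPt, Fin.snoc_castSucc]
    induction i using Fin.addCases with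
    | left j => simp only [Fin.append_left, wX]; exact hz _
    | right i =>
      simp only [Fin.append_right]
      induction i using Fin.lastCases with
      | last => rw [Fin.snoc_last]; exact hΥ _ (wRider_mem hz)
      | cast j => rw [Fin.snoc_castSucc]; exact hz _

/-- **Substituting the transverse rider** in a word-layout function. [folklore] -/
def famY (T : RFun ((n + (m + 1)) + 1)) (Υ : MvPolynomial (Fin (m + k)) ℚ) (hΥ : IsScale Υ) : RFun ((n + (m + k)) + 1) :=
  T.subst (laySubstY n Υ) fun z hz => by rw [aeval_laySubstY]; exact yPt_mem hΥ hz

omit hrel in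
/-- Value of `famY`. [folklore] -/
theorem fn_famY (T : RFun ((n + (m + 1)) + 1)) (Υ : MvPolynomial (Fin (m + k)) ℚ) (hΥ : IsScale Υ)
    (z : Fin ((n + (m + k)) + 1) → ℝ) : (famY T Υ hΥ).fn z = T.fn (yPt n Υ z) := by
  rw [famY, RFun.fn_subst, aeval_laySubstY]

omit hrel in
/-- Two word-layout points with the same word coordinates, riders and scale are equal. [folklore] -/
theorem layout_ext {N Mr : ℕ} {p q : Fin ((N + Mr) + 1) → ℝ} (h1 : wX p = wX q) (h2 : wRider p = wRider q)
    (h3 : wScale p = wScale q) : p = q := by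
  funext i
  induction i using Fin.lastCases with
  | last => exact h3
  | cast i =>
    induction i using Fin.addCases with
    | left j => exact congrFun h1 j
    | right j => exact congrFun h2 j

omit hrel in
/-- `yPt` commutes with peeling. [folklore] -/
theorem peelPt_yPt (Υ : MvPolynomial (Fin (m + k)) ℚ) (z : Fin (((n + 1) + (m + k)) + 1) → ℝ) :
    peelPt (yPt (n + 1) Υ z) = yPt n Υ (peelPt z) := by
  refine layout_ext ?_ ?_ ?_
  · funext j; rw [wX_peelPt, wX_yPt, wX_yPt, wX_peelPt]
  · rw [wRider_peelPt, wRider_yPt, wRider_yPt, wRider_peelPt]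
  · rw [wScale_peelPt, wScale_yPt, wX_yPt, wScale_yPt, wScale_peelPt]

/-- **`famY` of a word function is the word function of the substituted letters** (on the cube).
[folklore] -/
theorem fn_famY_Zw {ι : Type} (c : ℚ) (hc : 0 ≤ c) (d : ι → Letter (m + 1)) (hd : ∀ a, (d a).IsRegular c)
    {Υ : MvPolynomial (Fin (m + k)) ℚ} (hΥ : IsScale Υ) :
    ∀ (w : List ι) (z : Fin ((w.length + (m + k)) + 1) → ℝ), z ∈ KZ.cube ((w.length + (m + k)) + 1) →
      (famY (Zw c hc d hd w) Υ hΥ).fn z =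
        (Zw c hc (fun a => (d a).substY Υ) (fun a => (d a).isRegular_substY hΥ (hd a)) w).fn z := by
  -- value of a substituted letter factor
  have hcR : ∀ (ℓ : Letter (m + 1)) (e : Fin (m + k) → ℝ) (t : ℝ),
      (ℓ.substY Υ).cR e t = ℓ.cR (Fin.snoc (fun j => e (Fin.castAdd k j)) (aeval e Υ)) t := by
    intro ℓ e t
    cases ℓ with
    | inv => rfl
    | reg N M => simp only [Letter.substY, Letter.cR_reg, aeval_bind₁, aeval_riderSubstY]
  have hlastR : ∀ (ℓ : Letter (m + 1)) (e : Fin (m + k) → ℝ) (t : ℝ),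
      (ℓ.substY Υ).lastR e t = ℓ.lastR (Fin.snoc (fun j => e (Fin.castAdd k j)) (aeval e Υ)) t := by
    intro ℓ e t
    cases ℓ with
    | inv => rfl
    | reg N M => simp only [Letter.substY, Letter.lastR_reg, aeval_bind₁, aeval_riderSubstY]
  intro w
  induction w with
  | nil =>
    intro z _
    simp [famY, Zw, RFun.fn, RFun.subst]
  | cons a w ih =>
    intro z hz
    by_cases hw : w = []
    · subst hw
      simp only [List.length_singleton] at hz ⊢
      rw [fn_famY, fn_Zw_singleton, fn_Zw_singleton, wRider_yPt, wScale_yPt, wX_yPt, hlastR]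
    · simp only [List.length_cons] at hz ⊢
      rw [fn_famY, fn_Zw_cons c hc d hd a w hw _ (yPt_mem hΥ hz), fn_Zw_cons c hc _ _ a w hw z hz,
        wRider_yPt, wScale_yPt, wX_yPt, hcR, peelPt_yPt, ← fn_famY _ _ hΥ, ih (peelPt z) (peelPt_mem hz)]

end Transverse


/-! ## Scale-reading factors and the product rule for the scale derivative -/

section ScaleFactor

variable {R : Type} [CommRing R] {χ : KZ.FormalRep →+ R} (hrel : ∀ c ∈ KZ.relations, χ c = 0)
variable {m n k : ℕ}

/-- Embedding a function of (riders, scale) into the word layout (it ignores the word coordinates).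
[folklore] -/
def liftS (g : RFun (m + 1)) : RFun ((n + m) + 1) :=
  g.subst (Fin.lastCases (X (Fin.last (n + m))) fun j : Fin m => X (Fin.castSucc (Fin.natAdd n j))) fun z hz => by
    intro i
    induction i using Fin.lastCases with
    | last => simp only [Fin.lastCases_last, aeval_X]; exact hz _
    | cast j => simp only [Fin.lastCases_castSucc, aeval_X]; exact hz _

/-- Value of `liftS`. [folklore] -/
theorem fn_liftS (g : RFun (m + 1)) (z : Fin ((n + m) + 1) → ℝ) :
    (liftS (n := n) g).fn z = g.fn (Fin.snoc (wRider z) (wScale z)) := by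
  rw [liftS, RFun.fn_subst]
  congr 1
  funext i
  induction i using Fin.lastCases with
  | last => simp [wScale]
  | cast j => simp [wRider]

/-- A word-layout function multiplied by a factor reading only (riders, scale). [folklore] -/
def smulS (g : RFun (m + 1)) (T : RFun ((n + m) + 1)) : RFun ((n + m) + 1) := (liftS g).mul T

/-- Value of `smulS`. [folklore] -/
theorem fn_smulS (g : RFun (m + 1)) (T : RFun ((n + m) + 1)) (z : Fin ((n + m) + 1) → ℝ) :
    (smulS g T).fn z = g.fn (Fin.snoc (wRider z) (wScale z)) * T.fn z := by
  rw [smulS, RFun.fn_mul, fn_liftS]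

include hrel in
/-- A scale-reading factor moves into the multiplier: `⟪ρ · (g T)[π]⟫ = ⟪(ρ · g[π]) · T[π]⟫`. [folklore] -/
theorem chi_famTerm_smulS (ρ : RFun (m + k)) (g : RFun (m + 1)) (T : RFun ((n + m) + 1))
    (π : MvPolynomial (Fin (m + k)) ℚ) (hπ : IsScale π) :
    (famTerm ρ (smulS g T) π hπ).chi χ = (famTerm (ρ.mul (scaleFam g π hπ)) T π hπ).chi χ :=
  RFun.chi_congr hrel fun y _ => fn_famTerm_mul_scaleOnly ρ g (liftS g) (fn_liftS g) T π hπ y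

/-- The Euler derivative `θ g = τ ∂_τ g` of a (riders, scale) function. [folklore] -/
def thetaS (g : RFun (m + 1)) : RFun (m + 1) := (RFun.poly (X (Fin.last m))).mul g.dlast

/-- Value of `thetaS`. [folklore] -/
theorem fn_thetaS (g : RFun (m + 1)) (w : Fin (m + 1) → ℝ) : (thetaS g).fn w = w (Fin.last m) * g.dlast.fn w := by
  rw [thetaS, RFun.fn_mul, RFun.fn_poly, aeval_X]

/-- Riders of a `snoc` point. [folklore] -/
theorem wRider_snoc (p : Fin (n + m) → ℝ) (t : ℝ) :
    wRider (Fin.snoc p t : Fin ((n + m) + 1) → ℝ) = fun j => p (Fin.natAdd n j) := by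
  funext j; simp only [wRider]; exact Fin.snoc_castSucc (α := fun _ => ℝ) _ _ _

/-- Scale of a `snoc` point. [folklore] -/
theorem wScale_snoc (p : Fin (n + m) → ℝ) (t : ℝ) : wScale (Fin.snoc p t : Fin ((n + m) + 1) → ℝ) = t := by
  simp only [wScale]; exact Fin.snoc_last (α := fun _ => ℝ) _ _

/-- Word coordinates of a `snoc` point. [folklore] -/
theorem wX_snoc (p : Fin (n + m) → ℝ) (t : ℝ) :
    wX (Fin.snoc p t : Fin ((n + m) + 1) → ℝ) = fun j => p (Fin.castAdd m j) := by
  funext j; simp only [wX]; exact Fin.snoc_castSucc (α := fun _ => ℝ) _ _ _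

/-- **Product rule for the scale derivative**: `∂_τ(τ · g T) = g · ∂_τ(τ T) + (θ g) · T` at every
cube point. [folklore] -/
theorem fn_scaleDeriv_smulS (g : RFun (m + 1)) (T : RFun ((n + m) + 1)) {p : Fin (n + m) → ℝ}
    (hp : p ∈ KZ.cube (n + m)) {t₀ : ℝ} (ht₀ : t₀ ∈ Icc (0 : ℝ) 1) :
    (scaleDeriv (smulS g T)).fn (Fin.snoc p t₀) =
      (smulS g (scaleDeriv T)).fn (Fin.snoc p t₀) + (smulS (thetaS g) T).fn (Fin.snoc p t₀) := by
  set r : Fin m → ℝ := fun j => p (Fin.natAdd n j) with hr_def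
  have hr : r ∈ KZ.cube m := fun j => hp _
  have hU : ∀ t, (smulS g T).fn (Fin.snoc p t) = g.fn (Fin.snoc r t) * T.fn (Fin.snoc p t) := by
    intro t; rw [fn_smulS, wRider_snoc, wScale_snoc]
  have h1 : HasDerivAt (fun t => (smulS g T).fn (Fin.snoc p t)) ((smulS g T).dlast.fn (Fin.snoc p t₀)) t₀ :=
    (smulS g T).hasDerivAt_fn_snoc hp ht₀
  have h2 : HasDerivAt (fun t => g.fn (Fin.snoc r t) * T.fn (Fin.snoc p t))
      (g.dlast.fn (Fin.snoc r t₀) * T.fn (Fin.snoc p t₀) + g.fn (Fin.snoc r t₀) * T.dlast.fn (Fin.snoc p t₀)) t₀ :=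
    (g.hasDerivAt_fn_snoc hr ht₀).mul (T.hasDerivAt_fn_snoc hp ht₀)
  rw [funext hU] at h1
  have hd := h1.unique h2
  rw [fn_scaleDeriv _ hp ht₀, hd, hU, fn_smulS, fn_scaleDeriv _ hp ht₀, fn_smulS, fn_thetaS, wRider_snoc, wScale_snoc]
  simp only [Fin.snoc_last]
  ring

include hrel in
/-- The product rule at the level of classes: for a family term,
`⟪ρ · ∂_τ(τ g T)[π]⟫ = ⟪(ρ g[π]) · ∂_τ(τT)[π]⟫ + ⟪(ρ (θg)[π]) · T[π]⟫`. [folklore] -/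
theorem chi_famTerm_scaleDeriv_smulS (ρ : RFun (m + k)) (g : RFun (m + 1)) (T : RFun ((n + m) + 1))
    (π : MvPolynomial (Fin (m + k)) ℚ) (hπ : IsScale π) :
    (famTerm ρ (scaleDeriv (smulS g T)) π hπ).chi χ =
      (famTerm (ρ.mul (scaleFam g π hπ)) (scaleDeriv T) π hπ).chi χ +
        (famTerm (ρ.mul (scaleFam (thetaS g) π hπ)) T π hπ).chi χ := by
  rw [← chi_famTerm_smulS hrel ρ g, ← chi_famTerm_smulS hrel ρ (thetaS g), ← RFun.chi_add hrel]
  refine RFun.chi_congr hrel fun y hy => ?_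
  rw [RFun.fn_add hy, fn_famTerm, fn_famTerm, fn_famTerm]
  have hz := famPt_mem (n := n) hπ hy
  have hsplit : famPt n π y = Fin.snoc (Fin.init (famPt n π y)) (famPt n π y (Fin.last _)) := (Fin.snoc_init_self _).symm
  have hp : Fin.init (famPt n π y) ∈ KZ.cube (n + m) := fun i => hz _
  have ht : famPt n π y (Fin.last _) ∈ Icc (0 : ℝ) 1 := ⟨(hz _).1, (hz _).2⟩
  rw [hsplit, fn_scaleDeriv_smulS g T hp ht]
  ring

end ScaleFactor


/-! ## Degree-`j` evaluation of series at residues: `NCSeries.evalW` bookkeeping -/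

section EvalW

open NCSeries

variable {α : Type} [Fintype α] {R : Type} [CommRing R] {A : Type} [Ring A] [Algebra R A]

/-- Summing over `(n+1)`-tuples is summing over the initial segment and the last entry. [folklore] -/
theorem sum_fin_succ_fun_snoc {K : Type*} [AddCommMonoid K] (n : ℕ) (G : (Fin (n + 1) → α) → K) :
    ∑ f : Fin (n + 1) → α, G f = ∑ a : α, ∑ g : Fin n → α, G (Fin.snoc g a) := by
  rw [← (Fin.snocEquiv fun _ => α).sum_comp, Fintype.sum_prod_type]
  rfl

omit [Fintype α] in
/-- `List.ofFn` of a `snoc` tuple. [folklore] -/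
theorem ofFn_snoc {n : ℕ} (g : Fin n → α) (a : α) : List.ofFn (Fin.snoc g a : Fin (n + 1) → α) = List.ofFn g ++ [a] := by
  rw [List.ofFn_succ']; simp [Fin.snoc_castSucc, Fin.snoc_last]

/-- **Recursion in the weight, last letter**: `evalW (n+1) v φ = Σ_a evalW n v (φ(· a)) · v a`. [folklore] -/
theorem evalW_succ_snoc (n : ℕ) (v : α → A) (φ : NCSeries α R) :
    evalW (n + 1) v φ = ∑ a : α, evalW n v (fun w => φ (w ++ [a])) * v a := by
  unfold evalW
  rw [sum_fin_succ_fun_snoc]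
  refine Finset.sum_congr rfl fun a _ => ?_
  rw [Finset.sum_mul]
  refine Finset.sum_congr rfl fun g _ => ?_
  rw [ofFn_snoc, List.map_append, List.prod_append, List.map_singleton, List.prod_singleton, smul_mul_assoc]

/-- `evalW` of a difference. [folklore] -/
theorem evalW_sub' (n : ℕ) (v : α → A) (φ ψ : NCSeries α R) :
    evalW n v (φ - ψ) = evalW n v φ - evalW n v ψ := by
  simp [evalW, sub_smul, Finset.sum_sub_distrib]

/-- `evalW` of a negation. [folklore] -/
theorem evalW_neg' (n : ℕ) (v : α → A) (φ : NCSeries α R) : evalW n v (-φ) = -evalW n v φ := by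
  simp [evalW, neg_smul, Finset.sum_neg_distrib]

/-- `evalW` of a scalar multiple. [folklore] -/
theorem evalW_smul' (n : ℕ) (v : α → A) (r : R) (φ : NCSeries α R) : evalW n v (r • φ) = r • evalW n v φ := by
  simp [evalW, Finset.smul_sum, smul_smul]

/-- `evalW` of a finite sum of series. [folklore] -/
theorem evalW_finset_sum' {κ : Type*} (s : Finset κ) (n : ℕ) (v : α → A) (φ : κ → NCSeries α R) :
    evalW n v (∑ i ∈ s, φ i) = ∑ i ∈ s, evalW n v (φ i) := by
  classical
  induction s using Finset.induction_on with
  | empty => simp [evalW]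
  | insert a s ha ih => rw [Finset.sum_insert ha, Finset.sum_insert ha, evalW_add, ih]

/-- In positive weight only nonempty words are read. [folklore] -/
theorem evalW_succ_congr (n : ℕ) (v : α → A) {φ ψ : NCSeries α R} (h : ∀ w : List α, w ≠ [] → φ w = ψ w) :
    evalW (n + 1) v φ = evalW (n + 1) v ψ := by
  unfold evalW
  refine Finset.sum_congr rfl fun f _ => ?_
  rw [h _ (by rw [List.ofFn_succ]; exact List.cons_ne_nil _ _)]

/-- `evalW` only reads words of the given length. [folklore] -/
theorem evalW_congr_len (n : ℕ) (v : α → A) {φ ψ : NCSeries α R} (h : ∀ w : List α, w.length = n → φ w = ψ w) :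
    evalW n v φ = evalW n v ψ := by
  unfold evalW
  refine Finset.sum_congr rfl fun f _ => ?_
  rw [h _ (List.length_ofFn)]

/-- The series that is `r` on the empty word and `φ` elsewhere, read in weight `n`. [folklore] -/
theorem evalW_ite_nil (n : ℕ) (v : α → A) (r : R) (φ : NCSeries α R) :
    evalW n v (fun w => if w = [] then r else φ w) = if n = 0 then r • (1 : A) else evalW n v φ := by
  cases n with
  | zero => rw [evalW_zero, if_pos rfl, if_pos rfl]
  | succ n => rw [if_neg (Nat.succ_ne_zero n)]; exact evalW_succ_congr n v fun w hw => if_neg hw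

end EvalW

end Literature.NumberTheory.Transcendental.KZ.Cube
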